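import Mathlib.GroupTheory.Perm.Cycle.Type
import Mathlib.GroupTheory.Perm.Cycle.Factors
import Mathlib.GroupTheory.Perm.Fin
import Mathlib.GroupTheory.FreeGroup.CyclicallyReduced
import Literature.GroupTheory.CombinatorialGroupTheory.CommutatorLength
import Literature.GroupTheory.CombinatorialGroupTheory.CommutatorLengthNP
import Literature.GroupTheory.CombinatorialGroupTheory.RandomSclFreeGroupProofs
import HarnessLib

/-!
# The pairing certificate for commutator length (Heuer 2020, Cor. 2.5) — genus bounds for every word

Companion file of `CommutatorLength.lean` (Bardakov's pairing formula, [Heuer2020, Thm 2.4] with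
`k = 1`, discharged there as `BardakovFormula_holds` for non-empty CYCLICALLY REDUCED words) and
of `CommutatorLengthNP.lean` (the decision problem CL-`F_r`, whose inputs are RAW words
`w : List (Fin r × Bool)`, not assumed reduced). [Heuer2020, Cor 2.5] puts CL-`F` in `NP` with
"the certificate is a pairing"; for the verifier one needs the two genus inequalities for the raw
input word, which this file proves and packages as the certificate characterisation

  `(w, k) ∈ clDecisionSet r ↔ w = [] ∨ ∃ π pairing of w, |w|/2 + 1 ≤ 2k + orb(σπ)`

(`mem_clDecisionSet_iff_exists_isPairing`, `clInstanceCode_mem_clLanguage_iff_exists_isPairing`):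
no reduction of `w` is needed, and membership in the commutator subgroup need not be checked
separately (a paired word is balanced). What remains for `clLanguage r ∈ NP` is the
polynomial-time implementation of this predicate in the tree's `FP` string algebra.

The printed proofs go through surfaces (a pairing `π` glues the `|w|`-gon into a closed
orientable one-face surface with `orb(σπ)` vertices, of genus `g(π) = |w|/4 − orb(σπ)/2 + 1/2`
[Culler1981]). Mathlib has no surfaces, so this file gives a self-contained COMBINATORIAL
development (independent of, and different in technique from, the `PairingGenus` proof appended
to `CommutatorLength.lean`; here everything is phrased through the vertex count
`v = orb(σ ∘ π)` of words as functions on `Fin n`, `2 g(π) = |w|/2 + 1 − v`):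

* **Cycle counting** (`ncyc`, the number of `SameCycle` classes = `orbitCount`): refinement,
  "a transposition merges at most two cycles" (`ncyc_le_ncyc_swap_mul_add_one`), "splitting a
  point off its cycle adds one" (`ncyc_swap_apply_mul`, via the sign parity
  `sign_eq_one_iff_even`), conjugation invariance, and transport along an embedding with new
  fixed points (`ncyc_eq_of_embedding`).
* **Words and pairings** as functions on `Fin n` (`IsPairingFn`, `vtx`), rotation
  (`isPairingFn_rotate`, `vtx_rotate`), restriction/extension of pairings along embeddings of
  positions (`restrictPerm`, `extendPerm`).
* **Folding** a cancelling pair `x x⁻¹` (Culler's fold): at the front (`ncyc_fold_transport`,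
  `fold_front`: `v ≤ v' + 1`, `unfold_front`: `v = v' + 1`) and, by rotation, at any position
  (`fold_at`, `unfold_at`); on lists `pairing_delete`, `pairing_insert`.
* **Handle surgery** along two crossing pairs `X … Y … X⁻¹ … Y⁻¹`: the surgered word
  `U₃ U₂ U₁ U₄` has the same vertex count (`vtx_surgery_core`: four successive splittings and a
  transport; `surgEmb_finRotate`: the position combinatorics, valid also when blocks are empty;
  `surgery_restrict`, `surgery_extend`), and the group identity `handle_identity`
  `x w₂ y w₃ x⁻¹ w₄ y⁻¹ w₅ = [x w₃⁻¹ w₄⁻¹, w₄ w₃ w₂ y w₄⁻¹] · (w₄ w₃ w₂ w₅)` (cf. the interchange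
  identity of Fialkovski–Ivanov quoted as [Heuer2020, Thm 2.6]).
* **Upper bound for EVERY non-empty word** `2 cl(w) + v(π) ≤ |w|/2 + 1`
  (`Bardakov.two_mul_commutatorLength_add_vtx_le`): a fixed-point-free involution has an adjacent
  pair (fold it) or two crossing pairs (cut the handle: one commutator), by strong induction.
* **Lower bound for EVERY non-empty word of the commutator subgroup**
  `|w|/2 + 1 ≤ 2 cl(w) + v(π)` for some pairing (`Bardakov.exists_isPairingFn_of_mem_commutator`):
  for a reduced word spell out an optimal product of commutators as a word `X Y X⁻¹ Y⁻¹ ⋯` with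
  an explicit pairing of that genus (`exists_commutator_word`) and reduce freely, the genus never
  increasing (`pairing_of_red`); for an arbitrary word reduce, then un-reduce
  (`pairing_lift_red`; words reducing to nothing get a planar pairing,
  `exists_pairing_of_red_nil`) — "Bardakov's algorithm is also valid if the words are not
  reduced" [Heuer2020, §3.3].

Everything is proved; no named fact is introduced or used.

## References
* [Heuer2020] N. Heuer, *Computing commutator length is hard*, arXiv:2001.10230, §2.3.1,
  Thm 2.4, Cor 2.5, Thm 2.6, §3.3.
* [Bardakov2000] V. G. Bardakov, *Computing commutator length in free groups*, Algebra and
  Logic 39 (2000) 224–251.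
* [Culler1981] M. Culler, *Using surfaces to solve equations in free groups*, Topology 20 (1981)
  133–145.
-/

namespace Literature.GroupTheory.CombinatorialGroupTheory

namespace Bardakov

open Equiv Equiv.Perm

section CycleCount

variable {α : Type*} [Fintype α] [DecidableEq α]

/-- The number of cycles of a permutation of a finite type, fixed points counted as cycles of
length one: the number of classes of the relation `Equiv.Perm.SameCycle`. [folklore] -/
noncomputable def ncyc (f : Perm α) : ℕ :=
  Nat.card (Quotient (SameCycle.setoid f))

omit [DecidableEq α] in
/-- If every step `x ↦ g x` of a permutation `g` stays inside a class of an equivalence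
relation `t`, then every cycle of `g` lies inside a class of `t`. [folklore] -/
theorem rel_of_sameCycle {t : Setoid α} {g : Perm α} (h : ∀ x, t.r x (g x)) {x y : α}
    (hxy : g.SameCycle x y) : t.r x y := by
  obtain ⟨k, -, rfl⟩ := hxy.exists_pow_eq'
  clear hxy
  induction k with
  | zero =>
    simp only [pow_zero, Perm.coe_one, id_eq]
    exact t.iseqv.refl x
  | succ k ih =>
    rw [pow_succ', Perm.mul_apply]
    exact t.iseqv.trans ih (h _)

omit [DecidableEq α] in
/-- A coarser equivalence relation has at most as many classes. [folklore] -/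
theorem card_quotient_le_of_le {s t : Setoid α} (h : ∀ x y, s.r x y → t.r x y) :
    Nat.card (Quotient t) ≤ Nat.card (Quotient s) := by
  let φ : Quotient s → Quotient t :=
    fun q => Quotient.liftOn' q (Quotient.mk t) (fun a b hab => Quotient.sound (h a b hab))
  refine Nat.card_le_card_of_surjective φ ?_
  intro q
  induction q using Quotient.inductionOn with
  | h a => exact ⟨Quotient.mk s a, rfl⟩

omit [DecidableEq α] in
/-- If every step of `g` stays in a cycle of `f` (the cycles of `g` refine those of `f`), then
`f` has at most as many cycles as `g`. [folklore] -/
theorem ncyc_le_of_sameCycle_apply {f g : Perm α} (h : ∀ x, f.SameCycle x (g x)) :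
    ncyc f ≤ ncyc g :=
  card_quotient_le_of_le (s := SameCycle.setoid g) (t := SameCycle.setoid f)
    (fun _ _ hxy => rel_of_sameCycle (t := SameCycle.setoid f) h hxy)

/-- The equivalence relation obtained from `s` by additionally identifying the classes of `a`
and `b`. [folklore] -/
def joinSetoid (s : Setoid α) (a b : α) : Setoid α where
  r x y := s.r x y ∨ ((s.r x a ∨ s.r x b) ∧ (s.r y a ∨ s.r y b))
  iseqv := by
    refine ⟨fun x => Or.inl (s.iseqv.refl x), ?_, ?_⟩
    · rintro x y (h | ⟨h1, h2⟩)
      · exact Or.inl (s.iseqv.symm h)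
      · exact Or.inr ⟨h2, h1⟩
    · rintro x y z (h | ⟨h1, h2⟩) (h' | ⟨h1', h2'⟩)
      · exact Or.inl (s.iseqv.trans h h')
      · refine Or.inr ⟨?_, h2'⟩
        rcases h1' with h1' | h1'
        · exact Or.inl (s.iseqv.trans h h1')
        · exact Or.inr (s.iseqv.trans h h1')
      · refine Or.inr ⟨h1, ?_⟩
        rcases h2 with h2 | h2
        · exact Or.inl (s.iseqv.trans (s.iseqv.symm h') h2)
        · exact Or.inr (s.iseqv.trans (s.iseqv.symm h') h2)
      · exact Or.inr ⟨h1, h2'⟩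

omit [DecidableEq α] in
/-- Identifying two classes loses at most one class. [folklore] -/
theorem card_quotient_le_card_quotient_joinSetoid_add_one (s : Setoid α) (a b : α) :
    Nat.card (Quotient s) ≤ Nat.card (Quotient (joinSetoid s a b)) + 1 := by
  classical
  let t := joinSetoid s a b
  let proj : Quotient s → Quotient t :=
    fun q => Quotient.liftOn' q (Quotient.mk t) (fun x y hxy => Quotient.sound (Or.inl hxy))
  let Φ : Quotient s → Quotient t ⊕ Unit :=
    fun q => if q = Quotient.mk s b then Sum.inr () else Sum.inl (proj q)
  have hΦ : Function.Injective Φ := by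
    intro q₁ q₂ hq
    induction q₁ using Quotient.inductionOn with
    | h x₁ =>
    induction q₂ using Quotient.inductionOn with
    | h x₂ =>
    by_cases h₁ : Quotient.mk s x₁ = Quotient.mk s b <;>
      by_cases h₂ : Quotient.mk s x₂ = Quotient.mk s b
    · rw [h₁, h₂]
    · simp [Φ, h₁, h₂] at hq
    · simp [Φ, h₁, h₂] at hq
    · simp only [Φ, h₁, h₂, if_false, Sum.inl.injEq] at hq
      have hx : t.r x₁ x₂ := Quotient.exact hq
      rcases hx with hx | ⟨hx₁, hx₂⟩
      · exact Quotient.sound hx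
      · have hb₁ : ¬ s.r x₁ b := fun h => h₁ (Quotient.sound h)
        have hb₂ : ¬ s.r x₂ b := fun h => h₂ (Quotient.sound h)
        have ha₁ : s.r x₁ a := hx₁.resolve_right hb₁
        have ha₂ : s.r x₂ a := hx₂.resolve_right hb₂
        exact Quotient.sound (s.iseqv.trans ha₁ (s.iseqv.symm ha₂))
  calc Nat.card (Quotient s) ≤ Nat.card (Quotient t ⊕ Unit) := Nat.card_le_card_of_injective Φ hΦ
    _ = Nat.card (Quotient t) + 1 := by rw [Nat.card_sum, Nat.card_unique (α := Unit)]

/-- **Multiplying by a transposition merges at most two cycles**: `f` has at most one cycle more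
than `swap x y * f`. [folklore] -/
theorem ncyc_le_ncyc_swap_mul_add_one (f : Perm α) (x y : α) :
    ncyc f ≤ ncyc (swap x y * f) + 1 := by
  let t := joinSetoid (SameCycle.setoid f) x y
  have hstep : ∀ u, t.r u ((swap x y * f) u) := by
    intro u
    rw [Perm.mul_apply]
    have hu : f.SameCycle u (f u) := (sameCycle_apply_right (f := f)).2 (SameCycle.refl f u)
    by_cases hx : f u = x
    · rw [hx, swap_apply_left]
      rw [hx] at hu
      exact Or.inr ⟨Or.inl hu, Or.inr (SameCycle.refl f y)⟩
    by_cases hy : f u = y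
    · rw [hy, swap_apply_right]
      rw [hy] at hu
      exact Or.inr ⟨Or.inr hu, Or.inl (SameCycle.refl f x)⟩
    · rw [swap_apply_of_ne_of_ne hx hy]
      exact Or.inl hu
  have h1 : Nat.card (Quotient t) ≤ ncyc (swap x y * f) :=
    card_quotient_le_of_le (s := SameCycle.setoid (swap x y * f)) (t := t)
      (fun _ _ hxy => rel_of_sameCycle (t := t) hstep hxy)
  have h2 : ncyc f ≤ Nat.card (Quotient t) + 1 :=
    card_quotient_le_card_quotient_joinSetoid_add_one (SameCycle.setoid f) x y
  omega

/-- The symmetric form: `swap x y * f` has at most one cycle more than `f`. [folklore] -/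
theorem ncyc_swap_mul_le_add_one (f : Perm α) (x y : α) :
    ncyc (swap x y * f) ≤ ncyc f + 1 := by
  have h := ncyc_le_ncyc_swap_mul_add_one (swap x y * f) x y
  rwa [swap_mul_self_mul] at h

/-- The cycle class of a point: the cycle of `f` through it (a member of `cycleFactorsFinset f`)
if the point is moved, the point itself if it is fixed. [folklore] -/
noncomputable def cycleClass (f : Perm α) (x : α) :
    {c // c ∈ f.cycleFactorsFinset} ⊕ {x // f x = x} :=
  if h : f x = x then Sum.inr ⟨x, h⟩
  else Sum.inl ⟨f.cycleOf x, cycleOf_mem_cycleFactorsFinset_iff.2 (mem_support.2 h)⟩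

/-- Two points have the same cycle class iff they lie on the same cycle. [folklore] -/
theorem cycleClass_eq_iff (f : Perm α) (x y : α) :
    cycleClass f x = cycleClass f y ↔ f.SameCycle x y := by
  unfold cycleClass
  by_cases hx : f x = x <;> by_cases hy : f y = y
  · simp only [hx, hy, dite_true, Sum.inr.injEq, Subtype.mk.injEq]
    exact ⟨fun h => h ▸ SameCycle.refl _ _, fun h => (h.eq_of_left hx)⟩
  · simp only [hx, hy, dite_true, dite_false, reduceCtorEq, false_iff]
    exact fun h => hy (by rw [← h.eq_of_left hx]; exact hx)
  · simp only [hx, hy, dite_true, dite_false, reduceCtorEq, false_iff]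
    exact fun h => hx (by rw [← h.symm.eq_of_left hy]; exact hy)
  · simp only [hx, hy, dite_false, Sum.inl.injEq, Subtype.mk.injEq]
    exact (sameCycle_iff_cycleOf_eq_of_mem_support (mem_support.2 hx) (mem_support.2 hy)).symm

/-- Every cycle factor and every fixed point is a cycle class. [folklore] -/
theorem cycleClass_surjective (f : Perm α) : Function.Surjective (cycleClass f) := by
  rintro (⟨c, hc⟩ | ⟨x, hx⟩)
  · obtain ⟨a, ha⟩ := (mem_cycleFactorsFinset_iff.1 hc).1.nonempty_support
    have hfa : f a ≠ a := mem_support.1 (mem_cycleFactorsFinset_support_le hc ha)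
    refine ⟨a, ?_⟩
    simp only [cycleClass, hfa, dite_false, Sum.inl.injEq, Subtype.mk.injEq]
    exact (cycle_is_cycleOf ha hc).symm
  · exact ⟨x, by simp [cycleClass, hx]⟩

/-- The number of cycles is the number of cycle factors plus the number of fixed points.
[folklore] -/
theorem ncyc_eq_card_add_card (f : Perm α) :
    ncyc f = f.cycleFactorsFinset.card + Fintype.card {x // f x = x} := by
  let Θ : Quotient (SameCycle.setoid f) → {c // c ∈ f.cycleFactorsFinset} ⊕ {x // f x = x} :=
    fun q => Quotient.liftOn' q (cycleClass f) (fun a b hab => (cycleClass_eq_iff f a b).2 hab)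
  have hΘ : Function.Bijective Θ := by
    constructor
    · intro q₁ q₂ h
      induction q₁ using Quotient.inductionOn with
      | h a =>
      induction q₂ using Quotient.inductionOn with
      | h b =>
      exact Quotient.sound ((cycleClass_eq_iff f a b).1 h)
    · intro c
      obtain ⟨a, rfl⟩ := cycleClass_surjective f c
      exact ⟨Quotient.mk _ a, rfl⟩
  unfold ncyc
  rw [Nat.card_congr (Equiv.ofBijective Θ hΘ), Nat.card_sum, Nat.card_eq_fintype_card,
    Nat.card_eq_fintype_card, Fintype.card_coe]

/-- **Parity of the number of cycles**: `sign f = 1` iff `|α| + ncyc f` is even (a cycle of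
length `ℓ` has sign `(-1)^(ℓ-1)`). [folklore] -/
theorem sign_eq_one_iff_even (f : Perm α) :
    Perm.sign f = 1 ↔ Even (Fintype.card α + ncyc f) := by
  have h1 : Fintype.card {x // f x = x} = Fintype.card α - f.cycleType.sum := by
    rw [← card_fixedPoints]
    exact Fintype.card_congr (_root_.Equiv.refl _)
  have h2 : f.cycleFactorsFinset.card = f.cycleType.card := by
    rw [cycleType_def, Multiset.card_map]
    rfl
  have h3 : f.cycleType.sum ≤ Fintype.card α := f.sum_cycleType_le
  rw [sign_of_cycleType, neg_one_pow_eq_one_iff_even (by decide), ncyc_eq_card_add_card, h1, h2,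
    Nat.even_iff, Nat.even_iff]
  omega

/-- **Splitting a cycle**: if `a` is moved by `f`, then `swap a (f a) * f` (which fixes `a` and
otherwise follows `f`, skipping `a`) has exactly one cycle more than `f`. [folklore] -/
theorem ncyc_swap_apply_mul (f : Perm α) {a : α} (ha : f a ≠ a) :
    ncyc (swap a (f a) * f) = ncyc f + 1 := by
  set g := swap a (f a) * f with hg
  have h1 : ncyc f ≤ ncyc g := by
    refine ncyc_le_of_sameCycle_apply fun u => ?_
    rw [hg, Perm.mul_apply]
    have hu : f.SameCycle u (f u) := (sameCycle_apply_right (f := f)).2 (SameCycle.refl f u)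
    by_cases h₁ : f u = a
    · rw [h₁, swap_apply_left]
      rw [h₁] at hu
      exact hu.trans ((sameCycle_apply_right (f := f)).2 (SameCycle.refl f a))
    by_cases h₂ : f u = f a
    · rw [h₂, swap_apply_right]
      rw [f.injective h₂]
    · rwa [swap_apply_of_ne_of_ne h₁ h₂]
  have h2 : ncyc g ≤ ncyc f + 1 := ncyc_swap_mul_le_add_one f a (f a)
  have h3 : Perm.sign g = -Perm.sign f := by
    rw [hg, Perm.sign_mul, sign_swap (Ne.symm ha)]
    simp
  have hf := sign_eq_one_iff_even f
  have hg' := sign_eq_one_iff_even g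
  rw [h3] at hg'
  rw [Nat.even_iff] at hf hg'
  rcases Int.units_eq_one_or (Perm.sign f) with h | h
  · rw [h] at hf hg'
    have hf' : (Fintype.card α + ncyc f) % 2 = 0 := hf.1 rfl
    have hg'' : ¬ (Fintype.card α + ncyc g) % 2 = 0 := fun h' => neg_units_ne_self 1 (hg'.2 h')
    omega
  · rw [h] at hf hg'
    have hf' : ¬ (Fintype.card α + ncyc f) % 2 = 0 := fun h' => neg_units_ne_self 1 (hf.2 h')
    have hg'' : (Fintype.card α + ncyc g) % 2 = 0 := hg'.1 (neg_neg 1)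
    omega

omit [Fintype α] [DecidableEq α] in
/-- Conjugate permutations have the same number of cycles. [folklore] -/
theorem ncyc_conj (f g : Perm α) : ncyc (g * f * g⁻¹) = ncyc f := by
  unfold ncyc
  refine (Nat.card_congr (Quotient.congr (g : α ≃ α) fun a b => ?_)).symm
  change f.SameCycle a b ↔ (g * f * g⁻¹).SameCycle (g a) (g b)
  rw [sameCycle_conj]
  simp

omit [Fintype α] [DecidableEq α] in
/-- `f * g` and `g * f` have the same number of cycles. [folklore] -/
theorem ncyc_mul_comm (f g : Perm α) : ncyc (f * g) = ncyc (g * f) := by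
  have h : g * f = g * (f * g) * g⁻¹ := by group
  rw [h, ncyc_conj]

omit [DecidableEq α] in
/-- **Transport along an embedding**: if `g` on `β` restricts along an injection `e : α → β` to
`g'` and fixes every point outside the range of `e`, then `g` has `|β| - |α|` more cycles than
`g'` (the new fixed points). [folklore] -/
theorem ncyc_eq_of_embedding {β : Type*} [Fintype β] [DecidableEq β] (e : α → β)
    (he : Function.Injective e) (g' : Perm α) (g : Perm β) (hcomm : ∀ a, e (g' a) = g (e a))
    (hfix : ∀ b, b ∉ Set.range e → g b = b) :
    ncyc g = ncyc g' + (Fintype.card β - Fintype.card α) := by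
  classical
  have hpow : ∀ (k : ℕ) (a : α), e ((g' ^ k) a) = (g ^ k) (e a) := by
    intro k
    induction k with
    | zero => intro a; simp
    | succ k ih => intro a; rw [pow_succ', Perm.mul_apply, pow_succ', Perm.mul_apply, ← ih, hcomm]
  have hsc : ∀ a a', g'.SameCycle a a' ↔ g.SameCycle (e a) (e a') := by
    intro a a'
    constructor
    · intro h
      obtain ⟨k, -, rfl⟩ := h.exists_pow_eq'
      rw [hpow]
      exact (sameCycle_pow_right (f := g) (n := k)).2 (SameCycle.refl g (e a))
    · intro h
      obtain ⟨k, -, hk⟩ := h.exists_pow_eq'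
      rw [← hpow] at hk
      rw [← he hk]
      exact (sameCycle_pow_right (f := g') (n := k)).2 (SameCycle.refl g' a)
  let Φ : Quotient (SameCycle.setoid g') ⊕ {b // b ∉ Set.range e} → Quotient (SameCycle.setoid g) :=
    Sum.elim
      (fun q => Quotient.liftOn' q (fun a => Quotient.mk _ (e a))
        (fun a a' h => Quotient.sound ((hsc a a').1 h)))
      (fun b => Quotient.mk _ b.1)
  have hΦ : Function.Bijective Φ := by
    constructor
    · rintro (q₁ | ⟨b₁, hb₁⟩) (q₂ | ⟨b₂, hb₂⟩) h
      · induction q₁ using Quotient.inductionOn with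
        | h a₁ =>
        induction q₂ using Quotient.inductionOn with
        | h a₂ =>
        have h' : g.SameCycle (e a₁) (e a₂) := Quotient.exact h
        exact congrArg Sum.inl (Quotient.sound ((hsc a₁ a₂).2 h'))
      · exfalso
        induction q₁ using Quotient.inductionOn with
        | h a₁ =>
        have h' : g.SameCycle (e a₁) b₂ := Quotient.exact h
        obtain ⟨k, -, hk⟩ := h'.exists_pow_eq'
        rw [← hpow] at hk
        exact hb₂ ⟨_, hk⟩
      · exfalso
        induction q₂ using Quotient.inductionOn with
        | h a₂ =>
        have h' : g.SameCycle b₁ (e a₂) := Quotient.exact h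
        obtain ⟨k, -, hk⟩ := h'.symm.exists_pow_eq'
        rw [← hpow] at hk
        exact hb₁ ⟨_, hk⟩
      · have h' : g.SameCycle b₁ b₂ := Quotient.exact h
        have : b₁ = b₂ := h'.eq_of_left (hfix b₁ hb₁)
        subst this
        rfl
    · intro q
      induction q using Quotient.inductionOn with
      | h b =>
      by_cases hb : b ∈ Set.range e
      · obtain ⟨a, rfl⟩ := hb
        exact ⟨Sum.inl (Quotient.mk _ a), rfl⟩
      · exact ⟨Sum.inr ⟨b, hb⟩, rfl⟩
  have hcard : Fintype.card {b // b ∉ Set.range e} = Fintype.card β - Fintype.card α := by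
    rw [Fintype.card_subtype_compl, ← Set.card_range_of_injective he]
  unfold ncyc
  rw [← Nat.card_congr (Equiv.ofBijective Φ hΦ), Nat.card_sum, Nat.card_eq_fintype_card (α := {b // b ∉ Set.range e}),
    hcard]

/-- `ncyc` is the tree's `orbitCount` (cycle type plus fixed points) on `Fin n`. [folklore] -/
theorem ncyc_eq_orbitCount {n : ℕ} (σ : Perm (Fin n)) : ncyc σ = orbitCount σ := by
  rw [ncyc_eq_card_add_card, orbitCount, cycleType_def, Multiset.card_map, Fintype.card_subtype]
  rfl

omit [DecidableEq α] in
/-- Equivalent permutations (conjugate along an equivalence of types) have the same number of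
cycles. [folklore] -/
theorem ncyc_permCongr {β : Type*} [Fintype β] (e : α ≃ β) (f : Perm α) : ncyc (e.permCongr f) = ncyc f := by
  unfold ncyc
  refine (Nat.card_congr (Quotient.congr e fun a b => ?_)).symm
  change f.SameCycle a b ↔ (e.permCongr f).SameCycle (e a) (e b)
  have hpow : ∀ (k : ℕ) (x : α), ((e.permCongr f) ^ k) (e x) = e ((f ^ k) x) := by
    intro k
    induction k with
    | zero => intro x; simp
    | succ k ih => intro x; rw [pow_succ, Perm.mul_apply, Equiv.permCongr_apply,
        Equiv.symm_apply_apply, ih, pow_succ, Perm.mul_apply]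
  constructor
  · intro h
    obtain ⟨k, -, rfl⟩ := h.exists_pow_eq'
    rw [← hpow]
    exact (sameCycle_pow_right (f := e.permCongr f) (n := k)).2 (SameCycle.refl _ _)
  · intro h
    obtain ⟨k, -, hk⟩ := h.exists_pow_eq'
    rw [hpow] at hk
    rw [← e.injective hk]
    exact (sameCycle_pow_right (f := f) (n := k)).2 (SameCycle.refl _ _)

end CycleCount

/-! ### Words as functions on `Fin n`, pairings, and the vertex count -/

section Words

variable {α : Type*}

/-- The inverse letter: `(a, ε) ↦ (a, ¬ε)` (Mathlib's `FreeGroup` letters). [folklore] -/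
def linv (x : α × Bool) : α × Bool := (x.1, !x.2)

/-- `linv` is an involution. [folklore] -/
@[simp] theorem linv_linv (x : α × Bool) : linv (linv x) = x := by
  simp [linv]

/-- `linv` is injective. [folklore] -/
theorem linv_inj {x y : α × Bool} : linv x = linv y ↔ x = y :=
  ⟨fun h => by simpa using congrArg linv h, fun h => h ▸ rfl⟩

/-- The pairing condition of `IsPairing` for a word given as a function on `Fin n`: a
fixed-point-free involution matching every position with one carrying the inverse letter.
[cite: Heuer2020, §2.3.1] -/
def IsPairingFn {n : ℕ} (W : Fin n → α × Bool) (π : Perm (Fin n)) : Prop :=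
  (∀ i, π (π i) = i) ∧ (∀ i, π i ≠ i) ∧ ∀ i, W (π i) = linv (W i)

/-- `IsPairing w π` is `IsPairingFn w.get π`. [folklore] -/
theorem isPairing_iff_isPairingFn (w : List (α × Bool)) (π : Perm (Fin w.length)) :
    IsPairing w π ↔ IsPairingFn w.get π :=
  Iff.rfl

/-- The **vertex count** of a pairing `π` of a word of length `n`: the number of cycles of
`σ ∘ π`, `σ = finRotate n` the cyclic shift (the vertices of the one-face polygon gluing given
by `π`). It equals the tree's `orbitCount ((finRotate n).trans π)` (`orbitCount_trans_eq_vtx`).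
[cite: Heuer2020, Thm 2.4] -/
noncomputable def vtx (n : ℕ) (π : Perm (Fin n)) : ℕ :=
  ncyc (finRotate n * π)

/-- The tree's orbit count of `(finRotate n).trans π = π * finRotate n` is `vtx n π`. [folklore] -/
theorem orbitCount_trans_eq_vtx (n : ℕ) (π : Perm (Fin n)) :
    orbitCount ((finRotate n).trans π) = vtx n π := by
  rw [vtx, ← ncyc_eq_orbitCount, show (finRotate n).trans π = π * finRotate n from rfl,
    ncyc_mul_comm]

/-- The value of the cyclic shift. [folklore] -/
theorem val_finRotate {n : ℕ} (i : Fin n) :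
    ((finRotate n) i).val = if i.val + 1 = n then 0 else i.val + 1 := by
  cases n with
  | zero => exact i.elim0
  | succ m =>
    rw [coe_finRotate]
    by_cases h : i = Fin.last m
    · subst h
      simp
    · rw [if_neg h, if_neg]
      intro h'
      apply h
      ext
      rw [Fin.val_last]
      omega

/-- The value of a power of the cyclic shift. [folklore] -/
theorem val_finRotate_pow {n : ℕ} (k : ℕ) (i : Fin n) :
    (((finRotate n) ^ k) i).val = (i.val + k) % n := by
  induction k with
  | zero => simp [Nat.mod_eq_of_lt i.isLt]
  | succ k ih =>
    rw [pow_succ', Perm.mul_apply, val_finRotate, ih]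
    have hn : 0 < n := Fin.pos i
    have hlt : (i.val + k) % n < n := Nat.mod_lt _ hn
    have key : ∀ r, r < n → (if r + 1 = n then 0 else r + 1) = (r + 1) % n := by
      intro r hr
      split_ifs with h
      · rw [h, Nat.mod_self]
      · exact (Nat.mod_eq_of_lt (by omega)).symm
    rw [key _ hlt, Nat.mod_add_mod, Nat.add_assoc]

/-! ### Rotation -/

/-- Rotating a paired word: position `j` of the rotated word is position `σ^k j` of the old
one, and the pairing is conjugated accordingly. [folklore] -/
theorem isPairingFn_rotate {n : ℕ} {W : Fin n → α × Bool} {π : Perm (Fin n)}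
    (h : IsPairingFn W π) (k : ℕ) :
    IsPairingFn (W ∘ ((finRotate n) ^ k)) (((finRotate n) ^ k)⁻¹ * π * (finRotate n) ^ k) := by
  obtain ⟨h1, h2, h3⟩ := h
  refine ⟨fun i => ?_, fun i => ?_, fun i => ?_⟩
  · simp [Perm.mul_apply, h1]
  · simp only [Perm.mul_apply, ne_eq]
    intro hi
    have := congrArg ((finRotate n) ^ k) hi
    simp only [Perm.coe_inv, Equiv.apply_symm_apply] at this
    exact h2 _ this
  · simp only [Function.comp_apply, Perm.mul_apply, Perm.coe_inv, Equiv.apply_symm_apply]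
    exact h3 _

/-- Rotation does not change the vertex count. [folklore] -/
theorem vtx_rotate (n : ℕ) (π : Perm (Fin n)) (k : ℕ) :
    vtx n (((finRotate n) ^ k)⁻¹ * π * (finRotate n) ^ k) = vtx n π := by
  unfold vtx
  have hc : finRotate n * (((finRotate n) ^ k)⁻¹ * π * (finRotate n) ^ k) =
      ((finRotate n) ^ k)⁻¹ * (finRotate n * π) * (((finRotate n) ^ k)⁻¹)⁻¹ := by
    rw [inv_inv]
    have h1 : finRotate n * ((finRotate n) ^ k)⁻¹ = ((finRotate n) ^ k)⁻¹ * finRotate n :=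
      ((Commute.self_pow (finRotate n) k).inv_right).eq
    calc finRotate n * (((finRotate n) ^ k)⁻¹ * π * (finRotate n) ^ k)
        = (finRotate n * ((finRotate n) ^ k)⁻¹) * π * (finRotate n) ^ k := by group
      _ = (((finRotate n) ^ k)⁻¹ * finRotate n) * π * (finRotate n) ^ k := by rw [h1]
      _ = ((finRotate n) ^ k)⁻¹ * (finRotate n * π) * (finRotate n) ^ k := by group
  rw [hc, ncyc_conj]

/-- The rotated word as a list is `List.rotate`. [folklore] -/
theorem ofFn_comp_finRotate_pow {n : ℕ} (W : Fin n → α × Bool) (k : ℕ) :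
    List.ofFn (W ∘ ((finRotate n) ^ k)) = (List.ofFn W).rotate k := by
  apply List.ext_get
  · simp
  · intro i h₁ h₂
    rw [List.get_eq_getElem, List.get_eq_getElem, List.getElem_ofFn, List.getElem_rotate]
    simp only [Function.comp_apply, List.length_ofFn, List.getElem_ofFn]
    congr 1
    ext
    rw [val_finRotate_pow]

/-! ### Restricting and extending pairings along an embedding of positions -/

/-- Restriction of a permutation of `Fin n` preserving the range of an injection
`e : Fin m → Fin n` to a permutation of `Fin m`. [folklore] -/
noncomputable def restrictPerm {m n : ℕ} (e : Fin m → Fin n) (he : Function.Injective e)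
    (π : Perm (Fin n)) (hπ : ∀ x, π x ∈ Set.range e ↔ x ∈ Set.range e) : Perm (Fin m) :=
  (Equiv.ofInjective e he).symm.permCongr (π.subtypePerm hπ)

/-- The restriction is intertwined with `π` by `e`. [folklore] -/
theorem apply_restrictPerm {m n : ℕ} (e : Fin m → Fin n) (he : Function.Injective e)
    (π : Perm (Fin n)) (hπ : ∀ x, π x ∈ Set.range e ↔ x ∈ Set.range e) (j : Fin m) :
    e (restrictPerm e he π hπ j) = π (e j) := by
  unfold restrictPerm
  rw [Equiv.permCongr_apply, Equiv.symm_symm, Equiv.apply_ofInjective_symm he]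
  rfl

/-- Extension of a permutation of `Fin m` along an injection `e : Fin m → Fin n` by the identity
outside the range. [folklore] -/
noncomputable def extendPerm {m n : ℕ} (e : Fin m → Fin n) (he : Function.Injective e)
    (π' : Perm (Fin m)) : Perm (Fin n) := by
  classical exact π'.extendDomain (Equiv.ofInjective e he)

/-- The extension is intertwined with `π'` by `e`. [folklore] -/
theorem extendPerm_apply {m n : ℕ} (e : Fin m → Fin n) (he : Function.Injective e)
    (π' : Perm (Fin m)) (j : Fin m) : extendPerm e he π' (e j) = e (π' j) := by
  classical
  unfold extendPerm
  have h := Perm.extendDomain_apply_image π' (Equiv.ofInjective e he) j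
  simpa using h

/-- The extension fixes the points outside the range. [folklore] -/
theorem extendPerm_apply_of_not_mem {m n : ℕ} (e : Fin m → Fin n) (he : Function.Injective e)
    (π' : Perm (Fin m)) (x : Fin n) (hx : x ∉ Set.range e) : extendPerm e he π' x = x := by
  classical
  unfold extendPerm
  simpa using Perm.extendDomain_apply_not_subtype π' (Equiv.ofInjective e he) hx

/-- Restricting a pairing: if `π₁` is a letter-matching fixed-point-free involution on the range
of `e`, its restriction is a pairing of the restricted word. [folklore] -/
theorem isPairingFn_restrict {m n : ℕ} {W : Fin n → α × Bool} (e : Fin m → Fin n)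
    (he : Function.Injective e) (π₁ : Perm (Fin n))
    (hπ₁ : ∀ x, π₁ x ∈ Set.range e ↔ x ∈ Set.range e)
    (hinv : ∀ j, π₁ (π₁ (e j)) = e j) (hne : ∀ j, π₁ (e j) ≠ e j)
    (hlet : ∀ j, W (π₁ (e j)) = linv (W (e j))) :
    IsPairingFn (W ∘ e) (restrictPerm e he π₁ hπ₁) := by
  refine ⟨fun j => he ?_, fun j hj => hne j ?_, fun j => ?_⟩
  · rw [apply_restrictPerm e he π₁ hπ₁, apply_restrictPerm e he π₁ hπ₁, hinv]
  · have := congrArg e hj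
    rwa [apply_restrictPerm e he π₁ hπ₁] at this
  · simp only [Function.comp_apply]
    rw [apply_restrictPerm e he π₁ hπ₁, hlet]

/-- Extending a pairing: a pairing of the restricted word together with a letter-matching
fixed-point-free involution `κ` of the complement gives a pairing of the whole word. [folklore] -/
theorem isPairingFn_extend {m n : ℕ} {W : Fin n → α × Bool} (e : Fin m → Fin n)
    (he : Function.Injective e) (π' : Perm (Fin m)) (hπ' : IsPairingFn (W ∘ e) π')
    (κ : Perm (Fin n)) (hκe : ∀ j, κ (e j) = e j)
    (hκ : ∀ x, x ∉ Set.range e →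
      κ x ∉ Set.range e ∧ κ (κ x) = x ∧ κ x ≠ x ∧ W (κ x) = linv (W x)) :
    IsPairingFn W (extendPerm e he π' * κ) := by
  obtain ⟨h1, h2, h3⟩ := hπ'
  have hE : ∀ j, (extendPerm e he π' * κ) (e j) = e (π' j) := fun j => by
    rw [Perm.mul_apply, hκe, extendPerm_apply]
  have hR : ∀ x, x ∉ Set.range e → (extendPerm e he π' * κ) x = κ x := fun x hx => by
    rw [Perm.mul_apply, extendPerm_apply_of_not_mem _ _ _ _ (hκ x hx).1]
  refine ⟨fun x => ?_, fun x => ?_, fun x => ?_⟩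
  · by_cases hx : x ∈ Set.range e
    · obtain ⟨j, rfl⟩ := hx
      rw [hE, hE, h1]
    · rw [hR x hx, hR _ (hκ x hx).1, (hκ x hx).2.1]
  · by_cases hx : x ∈ Set.range e
    · obtain ⟨j, rfl⟩ := hx
      rw [hE]
      exact fun h => h2 j (he h)
    · rw [hR x hx]
      exact (hκ x hx).2.2.1
  · by_cases hx : x ∈ Set.range e
    · obtain ⟨j, rfl⟩ := hx
      rw [hE]
      exact h3 j
    · rw [hR x hx]
      exact (hκ x hx).2.2.2

/-! ### Folding a cancelling pair at the front of the word -/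

/-- The embedding `j ↦ j + 2` of the positions of `u` into those of `x :: x⁻¹ :: u`. [folklore] -/
def shift2 (m : ℕ) (j : Fin m) : Fin (m + 2) := j.addNat 2

/-- Value of `shift2`. [folklore] -/
@[simp] theorem val_shift2 {m : ℕ} (j : Fin m) : (shift2 m j).val = j.val + 2 := rfl

/-- `shift2` is injective. [folklore] -/
theorem shift2_injective (m : ℕ) : Function.Injective (shift2 m) := by
  intro a b h
  have := congrArg Fin.val h
  simp only [val_shift2] at this
  exact Fin.ext (by omega)

/-- The range of `shift2` is the set of positions `≥ 2`. [folklore] -/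
theorem mem_range_shift2_iff {m : ℕ} (x : Fin (m + 2)) : x ∈ Set.range (shift2 m) ↔ 2 ≤ x.val := by
  constructor
  · rintro ⟨j, rfl⟩
    simp
  · intro h
    exact ⟨⟨x.val - 2, by omega⟩, Fin.ext (by simp; omega)⟩

/-- The value of a transposition of `Fin n`, as an arithmetic conditional. [folklore] -/
theorem val_swap {n : ℕ} (a b x : Fin n) :
    (swap a b x).val = if x.val = a.val then b.val else if x.val = b.val then a.val else x.val := by
  rw [swap_apply_def]
  by_cases h₁ : x = a
  · subst h₁
    simp
  · have h₁' : x.val ≠ a.val := fun h => h₁ (Fin.ext h)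
    rw [if_neg h₁, if_neg h₁']
    by_cases h₂ : x = b
    · subst h₂
      simp
    · have h₂' : x.val ≠ b.val := fun h => h₂ (Fin.ext h)
      rw [if_neg h₂, if_neg h₂']

/-- **Transport for the front fold.** If `π₁` swaps the positions `0, 1` of a word of length
`m + 2` and restricts along `j ↦ j + 2` to `π'`, then `swap 0 2 ∘ σ ∘ π₁` has exactly two more
cycles than `σ' ∘ π'` (`σ, σ'` the cyclic shifts): it is the extension of `σ' ∘ π'` by two fixed
points. [folklore] -/
theorem ncyc_fold_transport {m : ℕ} (hm : 1 ≤ m) (π₁ : Perm (Fin (m + 2)))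
    (h0 : π₁ ⟨0, by omega⟩ = ⟨1, by omega⟩) (h1 : π₁ ⟨1, by omega⟩ = ⟨0, by omega⟩)
    (π' : Perm (Fin m)) (hrel : ∀ j, shift2 m (π' j) = π₁ (shift2 m j)) :
    ncyc (swap (⟨0, by omega⟩ : Fin (m + 2)) ⟨2, by omega⟩ * (finRotate (m + 2) * π₁)) =
      vtx m π' + 2 := by
  have h := ncyc_eq_of_embedding (shift2 m) (shift2_injective m) (finRotate m * π')
    (swap (⟨0, by omega⟩ : Fin (m + 2)) ⟨2, by omega⟩ * (finRotate (m + 2) * π₁)) ?_ ?_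
  · rw [h, vtx]
    simp
  · intro j
    have hr : (π' j).val < m := (π' j).isLt
    apply Fin.ext
    simp only [Perm.mul_apply, ← hrel, val_swap, val_finRotate, val_shift2]
    split_ifs <;> (try contradiction) <;> omega
  · intro b hb
    rw [mem_range_shift2_iff] at hb
    have hm2 : 0 < m + 2 := Nat.succ_pos _
    have hm1 : 1 < m + 2 := Nat.succ_lt_succ (Nat.succ_pos _)
    have hb' : b = ⟨0, hm2⟩ ∨ b = ⟨1, hm1⟩ := by
      rcases Nat.lt_or_ge b.val 1 with h | h
      · left
        apply Fin.ext
        show b.val = 0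
        omega
      · right
        apply Fin.ext
        show b.val = 1
        omega
    apply Fin.ext
    rcases hb' with hb' | hb' <;> rw [hb']
    · simp only [Perm.mul_apply, h0, val_swap, val_finRotate]
      split_ifs <;> (try contradiction) <;> omega
    · simp only [Perm.mul_apply, h1, val_swap, val_finRotate]
      split_ifs <;> (try contradiction) <;> omega

/-- **Folding a cancelling pair at the front loses at most one vertex.** If the word
`W = x x⁻¹ u` (`|u| ≥ 1`) carries a pairing `π`, then `u` carries a pairing `π'` with
`vtx W π ≤ vtx u π' + 1`: when `π` pairs the two front letters with each other this is an
equality (a fold of the polygon), otherwise `π'` re-pairs the two partners of the front letters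
and the vertex permutation changes by two splittings and one transposition. [folklore] -/
theorem fold_front {m : ℕ} (hm : 1 ≤ m) (W : Fin (m + 2) → α × Bool) (π : Perm (Fin (m + 2)))
    (hπ : IsPairingFn W π) (h01 : W ⟨1, by omega⟩ = linv (W ⟨0, by omega⟩)) :
    ∃ π' : Perm (Fin m), IsPairingFn (W ∘ shift2 m) π' ∧ vtx (m + 2) π ≤ vtx m π' + 1 := by
  obtain ⟨hinv, hfp, hlet⟩ := hπ
  have hm0 : 0 < m + 2 := by omega
  have hm1 : 1 < m + 2 := by omega
  have hm2 : 2 < m + 2 := by omega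
  set z0 : Fin (m + 2) := ⟨0, hm0⟩ with hz0
  set z1 : Fin (m + 2) := ⟨1, hm1⟩ with hz1
  set z2 : Fin (m + 2) := ⟨2, hm2⟩ with hz2
  have hv0 : z0.val = 0 := rfl
  have hv1 : z1.val = 1 := rfl
  have hv2 : z2.val = 2 := rfl
  set p := π z0 with hp
  set q := π z1 with hq
  have hp0 : p ≠ z0 := hfp z0
  have hq1 : q ≠ z1 := hfp z1
  have hpq : p ≠ q := fun h => by
    have := congrArg Fin.val (π.injective h)
    omega
  have hπp : π p = z0 := hinv z0
  have hπq : π q = z1 := hinv z1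
  have hp1q0 : p = z1 ↔ q = z0 := by
    constructor
    · intro h
      rw [hq, ← h, hπp]
    · intro h
      rw [hp, ← h, hπq]
  -- the adjusted pairing, swapping `0 ↔ 1` and `p ↔ q`
  set π₁ : Perm (Fin (m + 2)) := π * swap z1 p * swap z0 q with hπ₁
  have h10 : z1 ≠ z0 := fun h => by
    have := congrArg Fin.val h
    omega
  have hπ₁0 : π₁ z0 = z1 := by
    simp only [hπ₁, Perm.mul_apply, swap_apply_left]
    rw [swap_apply_of_ne_of_ne hq1 (Ne.symm hpq), hπq]
  have hπ₁1 : π₁ z1 = z0 := by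
    simp only [hπ₁, Perm.mul_apply]
    by_cases hq0 : q = z0
    · have hp1 : p = z1 := hp1q0.2 hq0
      rw [hq0, hp1, swap_self, swap_self, Equiv.refl_apply, Equiv.refl_apply, ← hq, hq0]
    · rw [swap_apply_of_ne_of_ne h10 (fun h => hq1 h.symm), swap_apply_left, hπp]
  have hπ₁p : p ≠ z1 → π₁ p = q := fun hp1 => by
    simp only [hπ₁, Perm.mul_apply]
    rw [swap_apply_of_ne_of_ne hp0 hpq, swap_apply_right, ← hq]
  have hπ₁q : p ≠ z1 → π₁ q = p := fun hp1 => by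
    simp only [hπ₁, Perm.mul_apply]
    rw [swap_apply_right, swap_apply_of_ne_of_ne h10.symm hp0.symm, ← hp]
  have hπ₁x : ∀ x, x ≠ z0 → x ≠ z1 → x ≠ p → x ≠ q → π₁ x = π x := fun x hx0 hx1 hxp hxq => by
    simp only [hπ₁, Perm.mul_apply]
    rw [swap_apply_of_ne_of_ne hx0 hxq, swap_apply_of_ne_of_ne hx1 hxp]
  -- `π₁` preserves the positions `≥ 2`
  have hlow : ∀ x : Fin (m + 2), x.val < 2 ↔ x = z0 ∨ x = z1 := by
    intro x
    constructor
    · intro h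
      rcases Nat.lt_or_ge x.val 1 with h' | h'
      · exact Or.inl (Fin.ext (by omega))
      · exact Or.inr (Fin.ext (by omega))
    · rintro (rfl | rfl) <;> omega
  have hR : ∀ x, π₁ x ∈ Set.range (shift2 m) ↔ x ∈ Set.range (shift2 m) := by
    intro x
    rw [mem_range_shift2_iff, mem_range_shift2_iff]
    constructor
    · intro h
      by_contra h'
      rcases (hlow x).1 (by omega) with rfl | rfl
      · rw [hπ₁0] at h
        omega
      · rw [hπ₁1] at h
        omega
    · intro h
      by_contra h'
      rcases (hlow (π₁ x)).1 (by omega) with h'' | h''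
      · rw [← hπ₁1] at h''
        have := π₁.injective h''
        subst this
        omega
      · rw [← hπ₁0] at h''
        have := π₁.injective h''
        subst this
        omega
  set π' := restrictPerm (shift2 m) (shift2_injective m) π₁ hR with hπ'
  have hrel : ∀ j, shift2 m (π' j) = π₁ (shift2 m j) :=
    fun j => apply_restrictPerm _ _ _ _ j
  -- letters of `p` and `q`
  have hWp : W p = linv (W z0) := by rw [hp, hlet]
  have hWq : W q = W z0 := by rw [hq, hlet, h01, linv_linv]
  -- `π'` is a pairing of `u`
  have hpair : IsPairingFn (W ∘ shift2 m) π' := by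
    refine isPairingFn_restrict (shift2 m) (shift2_injective m) π₁ hR ?_ ?_ ?_
    · intro j
      have hx2 : 2 ≤ (shift2 m j).val := by simp
      set x := shift2 m j with hx
      have hx0 : x ≠ z0 := fun h => by rw [h] at hx2; omega
      have hx1 : x ≠ z1 := fun h => by rw [h] at hx2; omega
      by_cases hxp : x = p
      · have hp1 : p ≠ z1 := hxp ▸ hx1
        rw [hxp, hπ₁p hp1, hπ₁q hp1]
      · by_cases hxq : x = q
        · have hq0 : q ≠ z0 := hxq ▸ hx0
          have hp1 : p ≠ z1 := fun h => hq0 (hp1q0.1 h)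
          rw [hxq, hπ₁q hp1, hπ₁p hp1]
        · rw [hπ₁x x hx0 hx1 hxp hxq]
          have hy0 : π x ≠ z0 := fun h => hxp (by rw [← hinv x, h, ← hp])
          have hy1 : π x ≠ z1 := fun h => hxq (by rw [← hinv x, h, ← hq])
          have hyp : π x ≠ p := fun h => hx0 (π.injective (by rw [h, hp]))
          have hyq : π x ≠ q := fun h => hx1 (π.injective (by rw [h, hq]))
          rw [hπ₁x (π x) hy0 hy1 hyp hyq, hinv]
    · intro j
      have hx2 : 2 ≤ (shift2 m j).val := by simp
      set x := shift2 m j with hx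
      have hx0 : x ≠ z0 := fun h => by rw [h] at hx2; omega
      have hx1 : x ≠ z1 := fun h => by rw [h] at hx2; omega
      by_cases hxp : x = p
      · have hp1 : p ≠ z1 := hxp ▸ hx1
        rw [hxp, hπ₁p hp1]
        exact Ne.symm hpq
      · by_cases hxq : x = q
        · have hq0 : q ≠ z0 := hxq ▸ hx0
          have hp1 : p ≠ z1 := fun h => hq0 (hp1q0.1 h)
          rw [hxq, hπ₁q hp1]
          exact hpq
        · rw [hπ₁x x hx0 hx1 hxp hxq]
          exact hfp x
    · intro j
      have hx2 : 2 ≤ (shift2 m j).val := by simp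
      set x := shift2 m j with hx
      have hx0 : x ≠ z0 := fun h => by rw [h] at hx2; omega
      have hx1 : x ≠ z1 := fun h => by rw [h] at hx2; omega
      by_cases hxp : x = p
      · have hp1 : p ≠ z1 := hxp ▸ hx1
        rw [hxp, hπ₁p hp1, hWq, hWp, linv_linv]
      · by_cases hxq : x = q
        · have hq0 : q ≠ z0 := hxq ▸ hx0
          have hp1 : p ≠ z1 := fun h => hq0 (hp1q0.1 h)
          rw [hxq, hπ₁q hp1, hWp, hWq]
        · rw [hπ₁x x hx0 hx1 hxp hxq]
          exact hlet x
  refine ⟨π', hpair, ?_⟩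
  -- counting
  have hT := ncyc_fold_transport hm π₁ hπ₁0 hπ₁1 π' hrel
  change ncyc (swap z0 z2 * (finRotate (m + 2) * π₁)) = vtx m π' + 2 at hT
  set σ := finRotate (m + 2) with hσ
  set τ := σ * π with hτ
  have hvtx : vtx (m + 2) π = ncyc τ := rfl
  have hσ0 : σ z0 = z1 := Fin.ext (by rw [hσ, val_finRotate]; split_ifs <;> omega)
  have hσ1 : σ z1 = z2 := Fin.ext (by rw [hσ, val_finRotate]; split_ifs <;> omega)
  have h20 : z2 ≠ z0 := fun h => by
    have := congrArg Fin.val h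
    omega
  have hστ : σ * π₁ = τ * swap z1 p * swap z0 q := by
    simp only [hπ₁, hτ, mul_assoc]
  suffices hkey : ncyc τ + 1 ≤ ncyc (swap z0 z2 * (σ * π₁)) by omega
  by_cases hp1 : p = z1
  · have hq0 : q = z0 := hp1q0.1 hp1
    have h1 : σ * π₁ = τ := by
      rw [hστ, hp1, hq0, swap_self, swap_self]
      try simp only [← Perm.one_def, mul_one]
    have hτ0 : τ z0 = z2 := by rw [hτ, Perm.mul_apply, ← hp, hp1, hσ1]
    rw [h1, ← hτ0, ncyc_swap_apply_mul τ (by rw [hτ0]; exact h20)]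
  · have hq0 : q ≠ z0 := fun h => hp1 (hp1q0.2 h)
    set τ₁ := τ * swap z1 p with hτ₁
    set τ₂ := τ₁ * swap z0 q with hτ₂
    have hτz1 : τ z1 = σ q := by rw [hτ, Perm.mul_apply, ← hq]
    have hτp : τ p = z1 := by rw [hτ, Perm.mul_apply, hπp, hσ0]
    have hτq : τ q = z2 := by rw [hτ, Perm.mul_apply, hπq, hσ1]
    have hτz1ne : τ z1 ≠ z1 := by
      rw [hτz1, ← hσ0]
      exact fun h => hq0 (σ.injective h)
    have h1 : τ₁ = swap z1 (τ z1) * τ := by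
      rw [hτ₁, mul_swap_eq_swap_mul, hτp, swap_comm]
    have hn1 : ncyc τ₁ = ncyc τ + 1 := by rw [h1, ncyc_swap_apply_mul τ hτz1ne]
    have h2 : τ₂ = swap (τ₁ z0) (τ₁ q) * τ₁ := by rw [hτ₂, mul_swap_eq_swap_mul]
    have hn2 : ncyc τ₁ ≤ ncyc τ₂ + 1 := by
      rw [h2]
      exact ncyc_le_ncyc_swap_mul_add_one τ₁ _ _
    have hτ₂0 : τ₂ z0 = z2 := by
      rw [hτ₂, Perm.mul_apply, swap_apply_left, hτ₁, Perm.mul_apply,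
        swap_apply_of_ne_of_ne hq1 (Ne.symm hpq), hτq]
    have h3 : swap z0 z2 * (σ * π₁) = swap z0 (τ₂ z0) * τ₂ := by
      rw [hτ₂0, hστ]
    have hn3 : ncyc (swap z0 z2 * (σ * π₁)) = ncyc τ₂ + 1 := by
      rw [h3, ncyc_swap_apply_mul τ₂ (by rw [hτ₂0]; exact h20)]
    omega

/-- **Unfolding: inserting a cancelling pair at the front adds a vertex.** A pairing `π'` of `u`
(`|u| ≥ 1`) extends to a pairing `π` of `x x⁻¹ u` pairing the two new letters with each other,
with `vtx (x x⁻¹ u) π = vtx u π' + 1`. [folklore] -/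
theorem unfold_front {m : ℕ} (hm : 1 ≤ m) (U : Fin m → α × Bool) (π' : Perm (Fin m))
    (hπ' : IsPairingFn U π') (x : α × Bool) :
    IsPairingFn (Fin.cons x (Fin.cons (linv x) U) : Fin (m + 2) → α × Bool)
        (extendPerm (shift2 m) (shift2_injective m) π' * swap ⟨0, by omega⟩ ⟨1, by omega⟩) ∧
      vtx (m + 2) (extendPerm (shift2 m) (shift2_injective m) π' * swap ⟨0, by omega⟩ ⟨1, by omega⟩) =
        vtx m π' + 1 := by
  have hm0 : 0 < m + 2 := by omega
  have hm1 : 1 < m + 2 := by omega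
  have hm2 : 2 < m + 2 := by omega
  set z0 : Fin (m + 2) := ⟨0, hm0⟩ with hz0
  set z1 : Fin (m + 2) := ⟨1, hm1⟩ with hz1
  set z2 : Fin (m + 2) := ⟨2, hm2⟩ with hz2
  have hv0 : z0.val = 0 := rfl
  have hv1 : z1.val = 1 := rfl
  have hv2 : z2.val = 2 := rfl
  set W : Fin (m + 2) → α × Bool := Fin.cons x (Fin.cons (linv x) U) with hW
  have hWe : ∀ j, W (shift2 m j) = U j := by
    intro j
    have : shift2 m j = (j.succ).succ := Fin.ext rfl
    rw [this, hW, Fin.cons_succ, Fin.cons_succ]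
  have hW0 : W z0 = x := rfl
  have hW1 : W z1 = linv x := rfl
  have hlow : ∀ y : Fin (m + 2), y ∉ Set.range (shift2 m) ↔ y = z0 ∨ y = z1 := by
    intro y
    rw [mem_range_shift2_iff, not_le]
    constructor
    · intro h
      rcases Nat.lt_or_ge y.val 1 with h' | h'
      · exact Or.inl (Fin.ext (by omega))
      · exact Or.inr (Fin.ext (by omega))
    · rintro (rfl | rfl) <;> omega
  have h01 : z0 ≠ z1 := fun h => by
    have := congrArg Fin.val h
    omega
  set π : Perm (Fin (m + 2)) := extendPerm (shift2 m) (shift2_injective m) π' * swap z0 z1 with hπ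
  have hπe : ∀ j, π (shift2 m j) = shift2 m (π' j) := by
    intro j
    rw [hπ, Perm.mul_apply, swap_apply_of_ne_of_ne, extendPerm_apply]
    · intro h
      have := congrArg Fin.val h
      rw [val_shift2] at this
      omega
    · intro h
      have := congrArg Fin.val h
      rw [val_shift2] at this
      omega
  have hπ0 : π z0 = z1 := by
    rw [hπ, Perm.mul_apply, swap_apply_left, extendPerm_apply_of_not_mem]
    exact (hlow z1).2 (Or.inr rfl)
  have hπ1 : π z1 = z0 := by
    rw [hπ, Perm.mul_apply, swap_apply_right, extendPerm_apply_of_not_mem]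
    exact (hlow z0).2 (Or.inl rfl)
  have hpair : IsPairingFn W π := by
    have hUe : IsPairingFn (W ∘ shift2 m) π' := by
      have : W ∘ shift2 m = U := funext hWe
      rw [this]
      exact hπ'
    refine isPairingFn_extend (shift2 m) (shift2_injective m) π' hUe (swap z0 z1) ?_ ?_
    · intro j
      apply swap_apply_of_ne_of_ne
      · intro h
        have := congrArg Fin.val h
        rw [val_shift2] at this
        omega
      · intro h
        have := congrArg Fin.val h
        rw [val_shift2] at this
        omega
    · intro y hy
      rcases (hlow y).1 hy with rfl | rfl
      · rw [swap_apply_left]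
        exact ⟨(hlow z1).2 (Or.inr rfl), swap_apply_right _ _, h01.symm, by rw [hW1, hW0]⟩
      · rw [swap_apply_right]
        exact ⟨(hlow z0).2 (Or.inl rfl), swap_apply_left _ _, h01, by rw [hW0, hW1, linv_linv]⟩
  refine ⟨hpair, ?_⟩
  have hT := ncyc_fold_transport hm π hπ0 hπ1 π' (fun j => (hπe j).symm)
  change ncyc (swap z0 z2 * (finRotate (m + 2) * π)) = vtx m π' + 2 at hT
  set σ := finRotate (m + 2) with hσ
  set τ := σ * π with hτ
  have hvtx : vtx (m + 2) π = ncyc τ := rfl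
  have hσ1 : σ z1 = z2 := Fin.ext (by rw [hσ, val_finRotate]; split_ifs <;> omega)
  have h20 : z2 ≠ z0 := fun h => by
    have := congrArg Fin.val h
    omega
  have hτ0 : τ z0 = z2 := by rw [hτ, Perm.mul_apply, hπ0, hσ1]
  have hn : ncyc (swap z0 z2 * τ) = ncyc τ + 1 := by
    rw [← hτ0, ncyc_swap_apply_mul τ (by rw [hτ0]; exact h20)]
  omega

/-! ### Folding and unfolding at an arbitrary position (by rotation) -/

/-- Rotating back: a pairing of the rotated word conjugates to a pairing of the word. [folklore] -/
theorem isPairingFn_rotate_inv {n : ℕ} {W : Fin n → α × Bool} {π : Perm (Fin n)} (k : ℕ)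
    (h : IsPairingFn (W ∘ ((finRotate n) ^ k)) π) :
    IsPairingFn W ((finRotate n) ^ k * π * ((finRotate n) ^ k)⁻¹) := by
  obtain ⟨h1, h2, h3⟩ := h
  refine ⟨fun i => ?_, fun i => ?_, fun i => ?_⟩
  · simp [Perm.mul_apply, h1]
  · simp only [Perm.mul_apply, ne_eq]
    intro hi
    apply h2 (((finRotate n) ^ k)⁻¹ i)
    have := congrArg (fun x => ((finRotate n) ^ k)⁻¹ x) hi
    simpa using this
  · have := h3 (((finRotate n) ^ k)⁻¹ i)
    simp only [Function.comp_apply, Perm.coe_inv, Equiv.apply_symm_apply] at this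
    simp only [Perm.mul_apply, Perm.coe_inv]
    exact this

/-- Rotating back does not change the vertex count. [folklore] -/
theorem vtx_rotate_inv (n : ℕ) (π : Perm (Fin n)) (k : ℕ) :
    vtx n ((finRotate n) ^ k * π * ((finRotate n) ^ k)⁻¹) = vtx n π := by
  have h := vtx_rotate n ((finRotate n) ^ k * π * ((finRotate n) ^ k)⁻¹) k
  rw [← h]
  congr 1
  group

/-- The order-preserving embedding of `Fin m` into `Fin (m + 2)` omitting the positions
`k, k + 1`. [folklore] -/
def skip2 (m k : ℕ) (j : Fin m) : Fin (m + 2) :=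
  if j.val < k then ⟨j.val, by omega⟩ else ⟨j.val + 2, by omega⟩

/-- Value of `skip2`. [folklore] -/
theorem val_skip2 (m k : ℕ) (j : Fin m) :
    (skip2 m k j).val = if j.val < k then j.val else j.val + 2 := by
  unfold skip2
  split_ifs <;> rfl

/-- `skip2` is injective. [folklore] -/
theorem skip2_injective (m k : ℕ) : Function.Injective (skip2 m k) := by
  intro a b h
  have := congrArg Fin.val h
  rw [val_skip2, val_skip2] at this
  apply Fin.ext
  split_ifs at this <;> omega

/-- The range of `skip2 m k` is everything but `k, k + 1`. [folklore] -/
theorem mem_range_skip2_iff {m k : ℕ} (hk : k ≤ m) (x : Fin (m + 2)) :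
    x ∈ Set.range (skip2 m k) ↔ x.val ≠ k ∧ x.val ≠ k + 1 := by
  constructor
  · rintro ⟨j, rfl⟩
    rw [val_skip2]
    split_ifs <;> omega
  · rintro ⟨h1, h2⟩
    rcases Nat.lt_or_ge x.val k with h | h
    · exact ⟨⟨x.val, by omega⟩, Fin.ext (by rw [val_skip2]; simp [h])⟩
    · refine ⟨⟨x.val - 2, by omega⟩, Fin.ext ?_⟩
      rw [val_skip2]
      simp only
      rw [if_neg (by omega)]
      omega

/-- Inserting the cancelling pair `x x⁻¹` at position `k ≤ m` of a word `U` of length `m`.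
[folklore] -/
def insert2 {m : ℕ} (k : ℕ) (hk : k ≤ m) (x : α × Bool) (U : Fin m → α × Bool) (i : Fin (m + 2)) :
    α × Bool :=
  if h₁ : i.val < k then U ⟨i.val, by omega⟩
  else if h₂ : i.val = k then x
  else if h₃ : i.val = k + 1 then linv x
  else U ⟨i.val - 2, by omega⟩

/-- `insert2` restricted along `skip2` is the original word. [folklore] -/
theorem insert2_skip2 {m : ℕ} {k : ℕ} (hk : k ≤ m) (x : α × Bool) (U : Fin m → α × Bool)
    (j : Fin m) : insert2 k hk x U (skip2 m k j) = U j := by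
  by_cases h : j.val < k
  · have hs : skip2 m k j = ⟨j.val, by omega⟩ := Fin.ext (by rw [val_skip2, if_pos h])
    rw [hs]
    unfold insert2
    rw [dif_pos (show (⟨j.val, by omega⟩ : Fin (m + 2)).val < k from h)]
  · have hs : skip2 m k j = ⟨j.val + 2, by omega⟩ := Fin.ext (by rw [val_skip2, if_neg h])
    rw [hs]
    unfold insert2
    rw [dif_neg (show ¬ (⟨j.val + 2, by omega⟩ : Fin (m + 2)).val < k by simp only; omega),
      dif_neg (show ¬ (⟨j.val + 2, by omega⟩ : Fin (m + 2)).val = k by simp only; omega),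
      dif_neg (show ¬ (⟨j.val + 2, by omega⟩ : Fin (m + 2)).val = k + 1 by simp only; omega)]
    congr 1

/-- The inserted letters. [folklore] -/
theorem insert2_apply_self {m : ℕ} {k : ℕ} (hk : k ≤ m) (x : α × Bool) (U : Fin m → α × Bool) :
    insert2 k hk x U ⟨k, by omega⟩ = x := by
  unfold insert2
  rw [dif_neg (show ¬ (⟨k, by omega⟩ : Fin (m + 2)).val < k by simp), dif_pos rfl]

/-- The inserted letters. [folklore] -/
theorem insert2_apply_succ {m : ℕ} {k : ℕ} (hk : k ≤ m) (x : α × Bool) (U : Fin m → α × Bool) :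
    insert2 k hk x U ⟨k + 1, by omega⟩ = linv x := by
  unfold insert2
  rw [dif_neg (show ¬ (⟨k + 1, by omega⟩ : Fin (m + 2)).val < k by simp),
    dif_neg (show ¬ (⟨k + 1, by omega⟩ : Fin (m + 2)).val = k by simp), dif_pos rfl]

/-- **Key index identity**: rotating by `k` carries the front embedding `shift2` to `skip2 m k`:
`σ^k (j + 2) = skip2 k (σ'^k j)` (`σ, σ'` the cyclic shifts of `Fin (m+2)`, `Fin m`). [folklore] -/
theorem finRotate_pow_shift2 {m k : ℕ} (hk : k ≤ m) (j : Fin m) :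
    ((finRotate (m + 2)) ^ k) (shift2 m j) = skip2 m k (((finRotate m) ^ k) j) := by
  apply Fin.ext
  rw [val_finRotate_pow, val_skip2, val_finRotate_pow, val_shift2]
  have hj := j.isLt
  rcases Nat.lt_or_ge (j.val + k) m with h | h
  · have e1 : (j.val + k) % m = j.val + k := Nat.mod_eq_of_lt h
    have e2 : (j.val + 2 + k) % (m + 2) = j.val + 2 + k := Nat.mod_eq_of_lt (by omega)
    rw [e1, e2, if_neg (by omega)]
    omega
  · have e1 : (j.val + k) % m = j.val + k - m := by
      rw [Nat.mod_eq_sub_mod h]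
      exact Nat.mod_eq_of_lt (by omega)
    have e2 : (j.val + 2 + k) % (m + 2) = j.val + k - m := by
      rw [Nat.mod_eq_sub_mod (by omega)]
      rw [Nat.mod_eq_of_lt (by omega)]
      omega
    rw [e1, e2, if_pos (by omega)]

/-- `σ^k 0 = k`. [folklore] -/
theorem finRotate_pow_apply_zero {m k : ℕ} (hk : k ≤ m) :
    ((finRotate (m + 2)) ^ k) ⟨0, by omega⟩ = ⟨k, by omega⟩ := by
  apply Fin.ext
  rw [val_finRotate_pow]
  show (0 + k) % (m + 2) = k
  rw [Nat.mod_eq_of_lt (by omega)]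
  omega

/-- `σ^k 1 = k + 1`. [folklore] -/
theorem finRotate_pow_apply_one {m k : ℕ} (hk : k ≤ m) :
    ((finRotate (m + 2)) ^ k) ⟨1, by omega⟩ = ⟨k + 1, by omega⟩ := by
  apply Fin.ext
  rw [val_finRotate_pow]
  show (1 + k) % (m + 2) = k + 1
  rw [Nat.mod_eq_of_lt (by omega)]
  omega

/-- Every position of `Fin (m + 2)` is `0`, `1` or `j + 2`. [folklore] -/
theorem fin_add_two_cases {m : ℕ} (i : Fin (m + 2)) :
    i = ⟨0, by omega⟩ ∨ i = ⟨1, by omega⟩ ∨ ∃ j : Fin m, i = shift2 m j := by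
  rcases Nat.lt_or_ge i.val 2 with h | h
  · rcases Nat.lt_or_ge i.val 1 with h' | h'
    · exact Or.inl (Fin.ext (by show i.val = 0; omega))
    · exact Or.inr (Or.inl (Fin.ext (by show i.val = 1; omega)))
  · exact Or.inr (Or.inr ⟨⟨i.val - 2, by omega⟩, Fin.ext (by show i.val = i.val - 2 + 2; omega)⟩)

/-- **Rotating a word to bring positions `k, k+1` to the front**: `W ∘ σ^k` is the word
`W k, W (k+1)` followed by the rotation of `W ∘ skip2 k`. [folklore] -/
theorem comp_finRotate_pow_eq_cons {m k : ℕ} (hk : k ≤ m) (W : Fin (m + 2) → α × Bool) :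
    W ∘ ((finRotate (m + 2)) ^ k) =
      (Fin.cons (W ⟨k, by omega⟩) (Fin.cons (W ⟨k + 1, by omega⟩)
        ((W ∘ skip2 m k) ∘ ⇑((finRotate m) ^ k))) : Fin (m + 2) → α × Bool) := by
  funext i
  rcases fin_add_two_cases i with rfl | rfl | ⟨j, rfl⟩
  · simp only [Function.comp_apply, finRotate_pow_apply_zero hk]
    rfl
  · simp only [Function.comp_apply, finRotate_pow_apply_one hk]
    rfl
  · have : shift2 m j = (j.succ).succ := Fin.ext rfl
    simp only [Function.comp_apply, finRotate_pow_shift2 hk]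
    rw [this, Fin.cons_succ, Fin.cons_succ]
    rfl

/-- **Folding a cancelling pair at position `k` loses at most one vertex**: if `W (k+1)` is the
inverse letter of `W k` (`|W| = m + 2`, `m ≥ 1`), every pairing `π` of `W` yields a pairing `π'`
of the word with the two letters deleted, with `vtx W π ≤ vtx π' + 1`. [folklore] -/
theorem fold_at {m k : ℕ} (hm : 1 ≤ m) (hk : k ≤ m) (W : Fin (m + 2) → α × Bool)
    (π : Perm (Fin (m + 2))) (hπ : IsPairingFn W π)
    (hkk : W ⟨k + 1, by omega⟩ = linv (W ⟨k, by omega⟩)) :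
    ∃ π' : Perm (Fin m), IsPairingFn (W ∘ skip2 m k) π' ∧ vtx (m + 2) π ≤ vtx m π' + 1 := by
  set ρ := (finRotate (m + 2)) ^ k with hρ
  set ρ' := (finRotate m) ^ k with hρ'
  have hrot := isPairingFn_rotate hπ k
  rw [comp_finRotate_pow_eq_cons hk W] at hrot
  obtain ⟨π'', hπ'', hle⟩ := fold_front hm _ _ hrot (by simpa using hkk)
  have hcomp : ((Fin.cons (W ⟨k, by omega⟩) (Fin.cons (W ⟨k + 1, by omega⟩)
      ((W ∘ skip2 m k) ∘ ⇑ρ')) : Fin (m + 2) → α × Bool)) ∘ shift2 m = (W ∘ skip2 m k) ∘ ⇑ρ' := by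
    funext j
    have : shift2 m j = (j.succ).succ := Fin.ext rfl
    simp only [Function.comp_apply, this, Fin.cons_succ]
  rw [hcomp] at hπ''
  refine ⟨ρ' * π'' * ρ'⁻¹, isPairingFn_rotate_inv k hπ'', ?_⟩
  rw [hρ', vtx_rotate_inv, ← vtx_rotate (m + 2) π k]
  exact hle

/-- **Inserting a cancelling pair at position `k` adds exactly one vertex**, for the explicit
extended pairing (the old pairing along `skip2`, the two new letters paired together). [folklore] -/
theorem unfold_at {m k : ℕ} (hm : 1 ≤ m) (hk : k ≤ m) (U : Fin m → α × Bool) (π' : Perm (Fin m))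
    (hπ' : IsPairingFn U π') (x : α × Bool) :
    IsPairingFn (insert2 k hk x U)
        (extendPerm (skip2 m k) (skip2_injective m k) π' * swap ⟨k, by omega⟩ ⟨k + 1, by omega⟩) ∧
      vtx (m + 2) (extendPerm (skip2 m k) (skip2_injective m k) π' *
        swap ⟨k, by omega⟩ ⟨k + 1, by omega⟩) = vtx m π' + 1 := by
  set zk : Fin (m + 2) := ⟨k, by omega⟩ with hzk
  set zk1 : Fin (m + 2) := ⟨k + 1, by omega⟩ with hzk1
  have hvk : zk.val = k := rfl
  have hvk1 : zk1.val = k + 1 := rfl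
  set W := insert2 k hk x U with hW
  set π := extendPerm (skip2 m k) (skip2_injective m k) π' * swap zk zk1 with hπ
  have hout : ∀ y : Fin (m + 2), y ∉ Set.range (skip2 m k) ↔ y = zk ∨ y = zk1 := by
    intro y
    rw [mem_range_skip2_iff hk]
    constructor
    · intro h
      by_cases h' : y.val = k
      · exact Or.inl (Fin.ext (by omega))
      · exact Or.inr (Fin.ext (by omega))
    · rintro (rfl | rfl) <;> omega
  have hkk1 : zk ≠ zk1 := fun h => by
    have := congrArg Fin.val h
    omega
  have hswe : ∀ j, swap zk zk1 (skip2 m k j) = skip2 m k j := by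
    intro j
    have hj := (mem_range_skip2_iff hk (skip2 m k j)).1 ⟨j, rfl⟩
    apply swap_apply_of_ne_of_ne
    · intro h
      exact hj.1 (by rw [h])
    · intro h
      exact hj.2 (by rw [h])
  have hπe : ∀ j, π (skip2 m k j) = skip2 m k (π' j) := by
    intro j
    rw [hπ, Perm.mul_apply, hswe, extendPerm_apply]
  have hπk : π zk = zk1 := by
    rw [hπ, Perm.mul_apply, swap_apply_left, extendPerm_apply_of_not_mem]
    exact (hout zk1).2 (Or.inr rfl)
  have hπk1 : π zk1 = zk := by
    rw [hπ, Perm.mul_apply, swap_apply_right, extendPerm_apply_of_not_mem]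
    exact (hout zk).2 (Or.inl rfl)
  have hWk : W zk = x := insert2_apply_self hk x U
  have hWk1 : W zk1 = linv x := insert2_apply_succ hk x U
  have hpair : IsPairingFn W π := by
    have hUe : IsPairingFn (W ∘ skip2 m k) π' := by
      have : W ∘ skip2 m k = U := funext fun j => insert2_skip2 hk x U j
      rw [this]
      exact hπ'
    refine isPairingFn_extend (skip2 m k) (skip2_injective m k) π' hUe (swap zk zk1) hswe ?_
    intro y hy
    rcases (hout y).1 hy with rfl | rfl
    · rw [swap_apply_left]
      exact ⟨(hout zk1).2 (Or.inr rfl), swap_apply_right _ _, hkk1.symm, by rw [hWk1, hWk]⟩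
    · rw [swap_apply_right]
      exact ⟨(hout zk).2 (Or.inl rfl), swap_apply_left _ _, hkk1, by rw [hWk, hWk1, linv_linv]⟩
  refine ⟨hpair, ?_⟩
  -- rotate to the front and count there
  set ρ := (finRotate (m + 2)) ^ k with hρ
  set ρ' := (finRotate m) ^ k with hρ'
  set πr := ρ⁻¹ * π * ρ with hπr
  set πr' := ρ'⁻¹ * π' * ρ' with hπr'
  have hm0 : 0 < m + 2 := by omega
  have hm1 : 1 < m + 2 := by omega
  have hm2 : 2 < m + 2 := by omega
  set z0 : Fin (m + 2) := ⟨0, hm0⟩ with hz0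
  set z1 : Fin (m + 2) := ⟨1, hm1⟩ with hz1
  set z2 : Fin (m + 2) := ⟨2, hm2⟩ with hz2
  have hv0 : z0.val = 0 := rfl
  have hv1 : z1.val = 1 := rfl
  have hv2 : z2.val = 2 := rfl
  have hρ0 : ρ z0 = zk := finRotate_pow_apply_zero hk
  have hρ1 : ρ z1 = zk1 := finRotate_pow_apply_one hk
  have hπr0 : πr z0 = z1 := by
    rw [hπr, Perm.mul_apply, Perm.mul_apply, hρ0, hπk, ← hρ1]
    simp
  have hπr1 : πr z1 = z0 := by
    rw [hπr, Perm.mul_apply, Perm.mul_apply, hρ1, hπk1, ← hρ0]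
    simp
  have hrel : ∀ j, shift2 m (πr' j) = πr (shift2 m j) := by
    intro j
    apply ρ.injective
    have e1 : ρ (shift2 m (πr' j)) = skip2 m k (π' (ρ' j)) := by
      rw [hρ, finRotate_pow_shift2 hk, ← hρ', hπr']
      simp [Perm.mul_apply]
    have e2 : ρ (πr (shift2 m j)) = skip2 m k (π' (ρ' j)) := by
      rw [hπr]
      simp only [Perm.mul_apply, Perm.coe_inv, Equiv.apply_symm_apply]
      rw [hρ, finRotate_pow_shift2 hk, ← hρ', hπe]
    rw [e1, e2]
  have hT := ncyc_fold_transport hm πr hπr0 hπr1 πr' hrel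
  have hvr' : vtx m πr' = vtx m π' := vtx_rotate m π' k
  have hvr : vtx (m + 2) πr = vtx (m + 2) π := vtx_rotate (m + 2) π k
  set σ := finRotate (m + 2) with hσ
  set τr := σ * πr with hτr
  have hvtx : vtx (m + 2) πr = ncyc τr := rfl
  have hσ1 : σ z1 = z2 := Fin.ext (by rw [hσ, val_finRotate]; split_ifs <;> omega)
  have h20 : z2 ≠ z0 := fun h => by
    have := congrArg Fin.val h
    omega
  have hτ0 : τr z0 = z2 := by rw [hτr, Perm.mul_apply, hπr0, hσ1]
  have hn : ncyc (swap z0 z2 * τr) = ncyc τr + 1 := by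
    rw [← hτ0, ncyc_swap_apply_mul τr (by rw [hτ0]; exact h20)]
  change ncyc (swap z0 z2 * τr) = vtx m πr' + 2 at hT
  omega

/-! ### The handle surgery: abstract core -/

/-- One splitting step: make `r` a fixed point of `g` by shortcutting `g⁻¹ r ↦ g r`. [folklore] -/
def splitAt {β : Type*} [DecidableEq β] (g : Perm β) (r : β) : Perm β :=
  swap r (g r) * g

/-- `splitAt g r` fixes `r`. [folklore] -/
theorem splitAt_apply_self {β : Type*} [DecidableEq β] (g : Perm β) (r : β) : splitAt g r r = r := by
  simp [splitAt, Perm.mul_apply]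

/-- `splitAt g r` keeps the fixed points of `g` other than `r`. [folklore] -/
theorem splitAt_apply_of_apply_eq {β : Type*} [DecidableEq β] (g : Perm β) (r : β) {x : β}
    (hx : g x = x) (hxr : x ≠ r) : splitAt g r x = x := by
  rw [splitAt, Perm.mul_apply, hx]
  apply swap_apply_of_ne_of_ne hxr
  intro h
  exact hxr (g.injective (by rw [hx, h]))

/-- Elsewhere `splitAt g r` follows `g`, except that the preimage of `r` is sent to `g r`.
[folklore] -/
theorem splitAt_apply {β : Type*} [DecidableEq β] (g : Perm β) (r x : β) :
    splitAt g r x = swap r (g r) (g x) := rfl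

/-- A genuine splitting adds one cycle. [folklore] -/
theorem ncyc_splitAt {β : Type*} [Fintype β] [DecidableEq β] (g : Perm β) {r : β} (hr : g r ≠ r) :
    ncyc (splitAt g r) = ncyc g + 1 :=
  ncyc_swap_apply_mul g hr

/-- **Abstract handle surgery.** Let `π` be a permutation of `Fin n`, `n = m + 4`, `e : Fin m → Fin n`
an injection missing exactly four points `a, b, c, d`, and `π'` a permutation of `Fin m`. Let
`τ = σ ∘ π` and let `g` be obtained from `τ` by successively splitting at `a, b, c, d`, each step
genuine. If `e` intertwines `σ' ∘ π'` with `g`, then `π` and `π'` have the same vertex count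
(`g` has exactly four more cycles than both). [folklore] -/
theorem vtx_surgery_core {n m : ℕ} (hnm : n = m + 4) (e : Fin m → Fin n)
    (he : Function.Injective e) (π : Perm (Fin n)) (π' : Perm (Fin m)) (a b c d : Fin n)
    (hab : a ≠ b) (hac : a ≠ c) (had : a ≠ d) (hbc : b ≠ c) (hbd : b ≠ d) (hcd : c ≠ d)
    (hR : ∀ x, x ∉ Set.range e → x = a ∨ x = b ∨ x = c ∨ x = d)
    (h1 : (finRotate n * π) a ≠ a)
    (h2 : splitAt (finRotate n * π) a b ≠ b)
    (h3 : splitAt (splitAt (finRotate n * π) a) b c ≠ c)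
    (h4 : splitAt (splitAt (splitAt (finRotate n * π) a) b) c d ≠ d)
    (hcomm : ∀ j, e ((finRotate m * π') j) =
      splitAt (splitAt (splitAt (splitAt (finRotate n * π) a) b) c) d (e j)) :
    vtx n π = vtx m π' := by
  set τ := finRotate n * π with hτ
  set g₁ := splitAt τ a with hg₁
  set g₂ := splitAt g₁ b with hg₂
  set g₃ := splitAt g₂ c with hg₃
  set g₄ := splitAt g₃ d with hg₄
  have hn₁ : ncyc g₁ = ncyc τ + 1 := ncyc_splitAt τ h1
  have hn₂ : ncyc g₂ = ncyc g₁ + 1 := ncyc_splitAt g₁ h2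
  have hn₃ : ncyc g₃ = ncyc g₂ + 1 := ncyc_splitAt g₂ h3
  have hn₄ : ncyc g₄ = ncyc g₃ + 1 := ncyc_splitAt g₃ h4
  -- fixed points
  have ha₁ : g₁ a = a := splitAt_apply_self τ a
  have ha₂ : g₂ a = a := splitAt_apply_of_apply_eq g₁ b ha₁ hab
  have hb₂ : g₂ b = b := splitAt_apply_self g₁ b
  have ha₃ : g₃ a = a := splitAt_apply_of_apply_eq g₂ c ha₂ hac
  have hb₃ : g₃ b = b := splitAt_apply_of_apply_eq g₂ c hb₂ hbc
  have hc₃ : g₃ c = c := splitAt_apply_self g₂ c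
  have ha₄ : g₄ a = a := splitAt_apply_of_apply_eq g₃ d ha₃ had
  have hb₄ : g₄ b = b := splitAt_apply_of_apply_eq g₃ d hb₃ hbd
  have hc₄ : g₄ c = c := splitAt_apply_of_apply_eq g₃ d hc₃ hcd
  have hd₄ : g₄ d = d := splitAt_apply_self g₃ d
  have hfix : ∀ x, x ∉ Set.range e → g₄ x = x := by
    intro x hx
    rcases hR x hx with rfl | rfl | rfl | rfl
    exacts [ha₄, hb₄, hc₄, hd₄]
  have hT := ncyc_eq_of_embedding e he (finRotate m * π') g₄ hcomm hfix
  simp only [Fintype.card_fin] at hT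
  change vtx n π = ncyc (finRotate m * π')
  change ncyc τ = _
  omega

/-! ### The handle surgery: the concrete position model

A word of length `n = n₁ + n₂ + n₃ + n₄ + 4` with four marked positions `0 < b < c < d`,
`b = n₁ + 1`, `c = n₁ + n₂ + 2`, `d = n₁ + n₂ + n₃ + 3` (the letters `X, Y, X⁻¹, Y⁻¹` of two
crossing pairs) is cut into the blocks `U₁ = (0, b)`, `U₂ = (b, c)`, `U₃ = (c, d)`, `U₄ = (d, n)`
of lengths `n₁, n₂, n₃, n₄`; the surgered word is `U₃ U₂ U₁ U₄`, of length `m = n₁ + n₂ + n₃ + n₄`. -/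

/-- The positions of the surgered word `U₃ U₂ U₁ U₄` inside the original word. [folklore] -/
def surgEmb (n₁ n₂ n₃ n₄ n : ℕ) (hn : n = n₁ + n₂ + n₃ + n₄ + 4) (j : Fin (n₁ + n₂ + n₃ + n₄)) :
    Fin n :=
  if h₁ : j.val < n₃ then ⟨n₁ + n₂ + 3 + j.val, by omega⟩
  else if h₂ : j.val < n₃ + n₂ then ⟨n₁ + 2 + (j.val - n₃), by omega⟩
  else if h₃ : j.val < n₃ + n₂ + n₁ then ⟨1 + (j.val - n₃ - n₂), by omega⟩
  else ⟨n₁ + n₂ + n₃ + 4 + (j.val - n₃ - n₂ - n₁), by omega⟩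

/-- Value of `surgEmb`. [folklore] -/
theorem val_surgEmb (n₁ n₂ n₃ n₄ n : ℕ) (hn : n = n₁ + n₂ + n₃ + n₄ + 4)
    (j : Fin (n₁ + n₂ + n₃ + n₄)) :
    (surgEmb n₁ n₂ n₃ n₄ n hn j).val =
      if j.val < n₃ then n₁ + n₂ + 3 + j.val
      else if j.val < n₃ + n₂ then n₁ + 2 + (j.val - n₃)
      else if j.val < n₃ + n₂ + n₁ then 1 + (j.val - n₃ - n₂)
      else n₁ + n₂ + n₃ + 4 + (j.val - n₃ - n₂ - n₁) := by
  unfold surgEmb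
  split_ifs <;> rfl

/-- `surgEmb` is injective. [folklore] -/
theorem surgEmb_injective (n₁ n₂ n₃ n₄ n : ℕ) (hn : n = n₁ + n₂ + n₃ + n₄ + 4) :
    Function.Injective (surgEmb n₁ n₂ n₃ n₄ n hn) := by
  intro i j hij
  have := congrArg Fin.val hij
  rw [val_surgEmb, val_surgEmb] at this
  apply Fin.ext
  split_ifs at this <;> omega

/-- The positions missed by `surgEmb` are exactly `0, b, c, d`. [folklore] -/
theorem not_mem_range_surgEmb_iff (n₁ n₂ n₃ n₄ n : ℕ) (hn : n = n₁ + n₂ + n₃ + n₄ + 4)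
    (x : Fin n) :
    x ∉ Set.range (surgEmb n₁ n₂ n₃ n₄ n hn) ↔
      (x.val = 0 ∨ x.val = n₁ + 1 ∨ x.val = n₁ + n₂ + 2 ∨ x.val = n₁ + n₂ + n₃ + 3) := by
  constructor
  · intro hx
    by_contra hne
    apply hx
    have hxn := x.isLt
    rcases Nat.lt_or_ge x.val (n₁ + 1) with h₁ | h₁
    · refine ⟨⟨n₃ + n₂ + (x.val - 1), by omega⟩, Fin.ext ?_⟩
      rw [val_surgEmb]
      simp only
      split_ifs <;> omega
    rcases Nat.lt_or_ge x.val (n₁ + n₂ + 2) with h₂ | h₂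
    · refine ⟨⟨n₃ + (x.val - n₁ - 2), by omega⟩, Fin.ext ?_⟩
      rw [val_surgEmb]
      simp only
      split_ifs <;> omega
    rcases Nat.lt_or_ge x.val (n₁ + n₂ + n₃ + 3) with h₃ | h₃
    · refine ⟨⟨x.val - n₁ - n₂ - 3, by omega⟩, Fin.ext ?_⟩
      rw [val_surgEmb]
      simp only
      split_ifs <;> omega
    · refine ⟨⟨n₃ + n₂ + n₁ + (x.val - n₁ - n₂ - n₃ - 4), by omega⟩, Fin.ext ?_⟩
      rw [val_surgEmb]
      simp only
      split_ifs <;> omega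
  · rintro hx ⟨j, rfl⟩
    rw [val_surgEmb] at hx
    have := j.isLt
    split_ifs at hx <;> omega

set_option maxHeartbeats 800000 in
-- the eight-case verification below is long but each step is linear arithmetic
/-- **The combinatorial heart of the surgery**: the cyclic successor of the surgered word
`U₃ U₂ U₁ U₄`, read through `surgEmb`, is the successor of the original word followed by the four
transpositions of the successive splittings at `0, b, c, d` (whose pivots `v₁, …, v₄` depend on
which blocks are empty). [folklore] -/
theorem surgEmb_finRotate (n₁ n₂ n₃ n₄ n : ℕ) (hn : n = n₁ + n₂ + n₃ + n₄ + 4)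
    (v₁ v₂ v₃ v₄ : Fin n) (hv₁ : v₁.val = n₁ + n₂ + 3)
    (hv₂ : (n₄ = 0 ∧ v₂.val = n₁ + n₂ + 3) ∨ (0 < n₄ ∧ v₂.val = n₁ + n₂ + n₃ + 4))
    (hv₃ : (n₁ = 0 ∧ v₃.val = v₂.val) ∨ (0 < n₁ ∧ v₃.val = 1))
    (hv₄ : (n₂ = 0 ∧ v₄.val = v₃.val) ∨ (0 < n₂ ∧ v₄.val = n₁ + 2))
    (j : Fin (n₁ + n₂ + n₃ + n₄)) :
    surgEmb n₁ n₂ n₃ n₄ n hn (finRotate (n₁ + n₂ + n₃ + n₄) j) =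
      swap ⟨n₁ + n₂ + n₃ + 3, by omega⟩ v₄ (swap ⟨n₁ + n₂ + 2, by omega⟩ v₃
        (swap ⟨n₁ + 1, by omega⟩ v₂ (swap ⟨0, by omega⟩ v₁
          (finRotate n (surgEmb n₁ n₂ n₃ n₄ n hn j))))) := by
  have hj := j.isLt
  apply Fin.ext
  -- the successor of `surgEmb j` in the original word
  have hx : ∀ (E : ℕ) (hE : E < n), (surgEmb n₁ n₂ n₃ n₄ n hn j).val + 1 = E →
      finRotate n (surgEmb n₁ n₂ n₃ n₄ n hn j) = ⟨E, hE⟩ := by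
    intro E hE hEq
    apply Fin.ext
    rw [val_finRotate]
    simp only
    rw [if_neg (by omega)]
    exact hEq
  have hx0 : (surgEmb n₁ n₂ n₃ n₄ n hn j).val + 1 = n →
      finRotate n (surgEmb n₁ n₂ n₃ n₄ n hn j) = ⟨0, by omega⟩ := by
    intro hEq
    apply Fin.ext
    rw [val_finRotate, if_pos hEq]
  have hL : (surgEmb n₁ n₂ n₃ n₄ n hn (finRotate (n₁ + n₂ + n₃ + n₄) j)).val =
      if j.val + 1 = n₁ + n₂ + n₃ + n₄ then
        (if 0 < n₃ then n₁ + n₂ + 3 else if 0 < n₂ then n₁ + 2 else if 0 < n₁ then 1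
          else n₁ + n₂ + n₃ + 4)
      else (if j.val + 1 < n₃ then n₁ + n₂ + 3 + (j.val + 1)
        else if j.val + 1 < n₃ + n₂ then n₁ + 2 + (j.val + 1 - n₃)
        else if j.val + 1 < n₃ + n₂ + n₁ then 1 + (j.val + 1 - n₃ - n₂)
        else n₁ + n₂ + n₃ + 4 + (j.val + 1 - n₃ - n₂ - n₁)) := by
    rw [val_surgEmb, val_finRotate]
    split_ifs <;> omega
  rw [hL]
  have hE := val_surgEmb n₁ n₂ n₃ n₄ n hn j
  -- eight cases: interior / last position of each of the four blocks
  rcases Nat.lt_or_ge j.val n₃ with hA | hA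
  · rw [if_pos hA] at hE
    rcases Nat.lt_or_ge (j.val + 1) n₃ with hA' | hA'
    · -- interior of U₃
      rw [hx (n₁ + n₂ + 4 + j.val) (by omega) (by omega)]
      simp only [val_swap, hv₁]
      rw [if_neg (show ¬ (n₁ + n₂ + 4 + j.val = 0) by omega),
        if_neg (show ¬ (n₁ + n₂ + 4 + j.val = n₁ + n₂ + 3) by omega),
        if_neg (show ¬ (n₁ + n₂ + 4 + j.val = n₁ + 1) by omega),
        if_neg (show ¬ (n₁ + n₂ + 4 + j.val = v₂.val) by omega),
        if_neg (show ¬ (n₁ + n₂ + 4 + j.val = n₁ + n₂ + 2) by omega),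
        if_neg (show ¬ (n₁ + n₂ + 4 + j.val = v₃.val) by omega),
        if_neg (show ¬ (n₁ + n₂ + 4 + j.val = n₁ + n₂ + n₃ + 3) by omega),
        if_neg (show ¬ (n₁ + n₂ + 4 + j.val = v₄.val) by omega),
        if_neg (show ¬ (j.val + 1 = n₁ + n₂ + n₃ + n₄) by omega), if_pos hA']
      omega
    · -- last position of U₃
      rw [hx (n₁ + n₂ + n₃ + 3) (by omega) (by omega)]
      simp only [val_swap, hv₁]
      rw [if_neg (show ¬ (n₁ + n₂ + n₃ + 3 = 0) by omega),
        if_neg (show ¬ (n₁ + n₂ + n₃ + 3 = n₁ + n₂ + 3) by omega),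
        if_neg (show ¬ (n₁ + n₂ + n₃ + 3 = n₁ + 1) by omega),
        if_neg (show ¬ (n₁ + n₂ + n₃ + 3 = v₂.val) by omega),
        if_neg (show ¬ (n₁ + n₂ + n₃ + 3 = n₁ + n₂ + 2) by omega),
        if_neg (show ¬ (n₁ + n₂ + n₃ + 3 = v₃.val) by omega), if_pos rfl]
      split_ifs <;> omega
  rcases Nat.lt_or_ge j.val (n₃ + n₂) with hB | hB
  · rw [if_neg (by omega), if_pos hB] at hE
    rcases Nat.lt_or_ge (j.val + 1) (n₃ + n₂) with hB' | hB'
    · -- interior of U₂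
      rw [hx (n₁ + 3 + (j.val - n₃)) (by omega) (by omega)]
      simp only [val_swap, hv₁]
      rw [if_neg (show ¬ (n₁ + 3 + (j.val - n₃) = 0) by omega),
        if_neg (show ¬ (n₁ + 3 + (j.val - n₃) = n₁ + n₂ + 3) by omega),
        if_neg (show ¬ (n₁ + 3 + (j.val - n₃) = n₁ + 1) by omega),
        if_neg (show ¬ (n₁ + 3 + (j.val - n₃) = v₂.val) by omega),
        if_neg (show ¬ (n₁ + 3 + (j.val - n₃) = n₁ + n₂ + 2) by omega),
        if_neg (show ¬ (n₁ + 3 + (j.val - n₃) = v₃.val) by omega),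
        if_neg (show ¬ (n₁ + 3 + (j.val - n₃) = n₁ + n₂ + n₃ + 3) by omega),
        if_neg (show ¬ (n₁ + 3 + (j.val - n₃) = v₄.val) by omega),
        if_neg (show ¬ (j.val + 1 = n₁ + n₂ + n₃ + n₄) by omega),
        if_neg (show ¬ (j.val + 1 < n₃) by omega), if_pos hB']
      omega
    · -- last position of U₂
      rw [hx (n₁ + n₂ + 2) (by omega) (by omega)]
      simp only [val_swap, hv₁]
      rw [if_neg (show ¬ (n₁ + n₂ + 2 = 0) by omega),
        if_neg (show ¬ (n₁ + n₂ + 2 = n₁ + n₂ + 3) by omega),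
        if_neg (show ¬ (n₁ + n₂ + 2 = n₁ + 1) by omega),
        if_neg (show ¬ (n₁ + n₂ + 2 = v₂.val) by omega), if_pos rfl,
        if_neg (show ¬ (j.val + 1 < n₃) by omega)]
      split_ifs <;> omega
  rcases Nat.lt_or_ge j.val (n₃ + n₂ + n₁) with hC | hC
  · rw [if_neg (by omega), if_neg (by omega), if_pos hC] at hE
    rcases Nat.lt_or_ge (j.val + 1) (n₃ + n₂ + n₁) with hC' | hC'
    · -- interior of U₁
      rw [hx (2 + (j.val - n₃ - n₂)) (by omega) (by omega)]
      simp only [val_swap, hv₁]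
      rw [if_neg (show ¬ (2 + (j.val - n₃ - n₂) = 0) by omega),
        if_neg (show ¬ (2 + (j.val - n₃ - n₂) = n₁ + n₂ + 3) by omega),
        if_neg (show ¬ (2 + (j.val - n₃ - n₂) = n₁ + 1) by omega),
        if_neg (show ¬ (2 + (j.val - n₃ - n₂) = v₂.val) by omega),
        if_neg (show ¬ (2 + (j.val - n₃ - n₂) = n₁ + n₂ + 2) by omega),
        if_neg (show ¬ (2 + (j.val - n₃ - n₂) = v₃.val) by omega),
        if_neg (show ¬ (2 + (j.val - n₃ - n₂) = n₁ + n₂ + n₃ + 3) by omega),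
        if_neg (show ¬ (2 + (j.val - n₃ - n₂) = v₄.val) by omega),
        if_neg (show ¬ (j.val + 1 = n₁ + n₂ + n₃ + n₄) by omega),
        if_neg (show ¬ (j.val + 1 < n₃) by omega), if_neg (show ¬ (j.val + 1 < n₃ + n₂) by omega),
        if_pos hC']
      omega
    · -- last position of U₁
      rw [hx (n₁ + 1) (by omega) (by omega)]
      simp only [val_swap, hv₁]
      rw [if_neg (show ¬ (n₁ + 1 = 0) by omega), if_neg (show ¬ (n₁ + 1 = n₁ + n₂ + 3) by omega),
        if_pos rfl, if_neg (show ¬ (j.val + 1 < n₃) by omega),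
        if_neg (show ¬ (j.val + 1 < n₃ + n₂) by omega)]
      split_ifs <;> omega
  · rw [if_neg (by omega), if_neg (by omega), if_neg (by omega)] at hE
    rcases Nat.lt_or_ge (j.val + 1) (n₁ + n₂ + n₃ + n₄) with hD' | hD'
    · -- interior of U₄
      rw [hx (n₁ + n₂ + n₃ + 5 + (j.val - n₃ - n₂ - n₁)) (by omega) (by omega)]
      simp only [val_swap, hv₁]
      rw [if_neg (show ¬ (n₁ + n₂ + n₃ + 5 + (j.val - n₃ - n₂ - n₁) = 0) by omega),
        if_neg (show ¬ (n₁ + n₂ + n₃ + 5 + (j.val - n₃ - n₂ - n₁) = n₁ + n₂ + 3) by omega),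
        if_neg (show ¬ (n₁ + n₂ + n₃ + 5 + (j.val - n₃ - n₂ - n₁) = n₁ + 1) by omega),
        if_neg (show ¬ (n₁ + n₂ + n₃ + 5 + (j.val - n₃ - n₂ - n₁) = v₂.val) by omega),
        if_neg (show ¬ (n₁ + n₂ + n₃ + 5 + (j.val - n₃ - n₂ - n₁) = n₁ + n₂ + 2) by omega),
        if_neg (show ¬ (n₁ + n₂ + n₃ + 5 + (j.val - n₃ - n₂ - n₁) = v₃.val) by omega),
        if_neg (show ¬ (n₁ + n₂ + n₃ + 5 + (j.val - n₃ - n₂ - n₁) = n₁ + n₂ + n₃ + 3) by omega),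
        if_neg (show ¬ (n₁ + n₂ + n₃ + 5 + (j.val - n₃ - n₂ - n₁) = v₄.val) by omega),
        if_neg (show ¬ (j.val + 1 = n₁ + n₂ + n₃ + n₄) by omega),
        if_neg (show ¬ (j.val + 1 < n₃) by omega), if_neg (show ¬ (j.val + 1 < n₃ + n₂) by omega),
        if_neg (show ¬ (j.val + 1 < n₃ + n₂ + n₁) by omega)]
      omega
    · -- last position of U₄ (the last position of the word)
      rw [hx0 (by omega)]
      simp only [val_swap, hv₁, ite_true]
      rw [if_neg (show ¬ (n₁ + n₂ + 3 = n₁ + 1) by omega),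
        if_neg (show ¬ (n₁ + n₂ + 3 = v₂.val) by omega),
        if_neg (show ¬ (n₁ + n₂ + 3 = n₁ + n₂ + 2) by omega),
        if_neg (show ¬ (n₁ + n₂ + 3 = v₃.val) by omega),
        if_pos (show j.val + 1 = n₁ + n₂ + n₃ + n₄ by omega)]
      split_ifs <;> omega

/-- **The handle surgery preserves the vertex count.** For a permutation `π` of the positions of
a word of length `n = n₁ + n₂ + n₃ + n₄ + 4 > 4` pairing `z0 ↔ zc` and `zb ↔ zd`
(positions `0`, `b = n₁ + 1`, `c = n₁ + n₂ + 2`, `d = n₁ + n₂ + n₃ + 3`), and the permutation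
`π'` of the positions of the surgered word `U₃ U₂ U₁ U₄` corresponding to it along `surgEmb`,
the vertex counts agree: the closed one-face surface loses a handle and four edges but no
vertex. [folklore] -/
theorem vtx_surgery {n₁ n₂ n₃ n₄ n : ℕ} (hn : n = n₁ + n₂ + n₃ + n₄ + 4)
    (hm : 0 < n₁ + n₂ + n₃ + n₄) (z0 zb zc zd : Fin n) (hv0 : z0.val = 0)
    (hvb : zb.val = n₁ + 1) (hvc : zc.val = n₁ + n₂ + 2) (hvd : zd.val = n₁ + n₂ + n₃ + 3)
    (π : Perm (Fin n)) (π' : Perm (Fin (n₁ + n₂ + n₃ + n₄)))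
    (hπ0 : π z0 = zc) (hπb : π zb = zd) (hπc : π zc = z0) (hπd : π zd = zb)
    (hππ' : ∀ j, surgEmb n₁ n₂ n₃ n₄ n hn (π' j) = π (surgEmb n₁ n₂ n₃ n₄ n hn j)) :
    vtx n π = vtx (n₁ + n₂ + n₃ + n₄) π' := by
  set e := surgEmb n₁ n₂ n₃ n₄ n hn with he
  set σ := finRotate n with hσ
  set τ := σ * π with hτ
  set v₁ := τ z0 with hv₁
  set g₁ := splitAt τ z0 with hg₁
  set v₂ := g₁ zb with hv₂
  set g₂ := splitAt g₁ zb with hg₂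
  set v₃ := g₂ zc with hv₃
  set g₃ := splitAt g₂ zc with hg₃
  set v₄ := g₃ zd with hv₄
  set g₄ := splitAt g₃ zd with hg₄
  have hσv : ∀ (x : Fin n), (σ x).val = if x.val + 1 = n then 0 else x.val + 1 := fun x => by
    rw [hσ, val_finRotate]
  have hv₁' : v₁.val = n₁ + n₂ + 3 := by
    have : v₁.val = (σ (π z0)).val := rfl
    rw [this, hπ0, hσv, if_neg (by omega)]
    omega
  have hv₂' : (n₄ = 0 ∧ v₂.val = n₁ + n₂ + 3) ∨ (0 < n₄ ∧ v₂.val = n₁ + n₂ + n₃ + 4) := by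
    have : v₂.val = (swap z0 v₁ (σ (π zb))).val := rfl
    rw [this, val_swap, hπb, hσv]
    by_cases h4 : n₄ = 0
    · left
      rw [if_pos (show zd.val + 1 = n by omega), if_pos (show 0 = z0.val by omega)]
      exact ⟨h4, hv₁'⟩
    · right
      rw [if_neg (show ¬ (zd.val + 1 = n) by omega), if_neg (show ¬ (zd.val + 1 = z0.val) by omega),
        if_neg (show ¬ (zd.val + 1 = v₁.val) by omega)]
      omega
  have hv₃' : (n₁ = 0 ∧ v₃.val = v₂.val) ∨ (0 < n₁ ∧ v₃.val = 1) := by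
    have : v₃.val = (swap zb v₂ (swap z0 v₁ (σ (π zc)))).val := rfl
    rw [this, val_swap, val_swap, hπc, hσv, if_neg (show ¬ (z0.val + 1 = n) by omega),
      if_neg (show ¬ (z0.val + 1 = z0.val) by omega), if_neg (show ¬ (z0.val + 1 = v₁.val) by omega)]
    by_cases h1 : n₁ = 0
    · left
      rw [if_pos (show z0.val + 1 = zb.val by omega)]
      exact ⟨h1, rfl⟩
    · right
      rw [if_neg (show ¬ (z0.val + 1 = zb.val) by omega),
        if_neg (show ¬ (z0.val + 1 = v₂.val) by omega)]
      omega
  have hv₄' : (n₂ = 0 ∧ v₄.val = v₃.val) ∨ (0 < n₂ ∧ v₄.val = n₁ + 2) := by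
    have : v₄.val = (swap zc v₃ (swap zb v₂ (swap z0 v₁ (σ (π zd))))).val := rfl
    rw [this, val_swap, val_swap, val_swap, hπd, hσv, if_neg (show ¬ (zb.val + 1 = n) by omega),
      if_neg (show ¬ (zb.val + 1 = z0.val) by omega), if_neg (show ¬ (zb.val + 1 = v₁.val) by omega),
      if_neg (show ¬ (zb.val + 1 = zb.val) by omega), if_neg (show ¬ (zb.val + 1 = v₂.val) by omega)]
    by_cases h2 : n₂ = 0
    · left
      rw [if_pos (show zb.val + 1 = zc.val by omega)]
      exact ⟨h2, rfl⟩
    · right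
      rw [if_neg (show ¬ (zb.val + 1 = zc.val) by omega),
        if_neg (show ¬ (zb.val + 1 = v₃.val) by omega)]
      omega
  refine vtx_surgery_core hn e (surgEmb_injective _ _ _ _ _ hn) π π' z0 zb zc zd
    (fun h => by have := congrArg Fin.val h; omega)
    (fun h => by have := congrArg Fin.val h; omega)
    (fun h => by have := congrArg Fin.val h; omega)
    (fun h => by have := congrArg Fin.val h; omega)
    (fun h => by have := congrArg Fin.val h; omega)
    (fun h => by have := congrArg Fin.val h; omega)
    ?_ ?_ ?_ ?_ ?_ ?_
  · intro x hx
    rcases (not_mem_range_surgEmb_iff _ _ _ _ _ hn x).1 hx with h | h | h | h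
    · exact Or.inl (Fin.ext (by omega))
    · exact Or.inr (Or.inl (Fin.ext (by omega)))
    · exact Or.inr (Or.inr (Or.inl (Fin.ext (by omega))))
    · exact Or.inr (Or.inr (Or.inr (Fin.ext (by omega))))
  · change v₁ ≠ _
    intro h
    have := congrArg Fin.val h
    omega
  · change v₂ ≠ _
    intro h
    have := congrArg Fin.val h
    omega
  · change v₃ ≠ _
    intro h
    have := congrArg Fin.val h
    omega
  · change v₄ ≠ _
    intro h
    have := congrArg Fin.val h
    omega
  · intro j
    have h1 : g₄ (e j) = swap zd v₄ (swap zc v₃ (swap zb v₂ (swap z0 v₁ (σ (π (e j)))))) := rfl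
    change e (finRotate (n₁ + n₂ + n₃ + n₄) (π' j)) = g₄ (e j)
    rw [h1, ← hππ' j]
    have key := surgEmb_finRotate n₁ n₂ n₃ n₄ n hn v₁ v₂ v₃ v₄ hv₁' hv₂' hv₃' hv₄' (π' j)
    have e0 : (⟨0, by omega⟩ : Fin n) = z0 := Fin.ext (by simp [hv0])
    have eb : (⟨n₁ + 1, by omega⟩ : Fin n) = zb := Fin.ext (by simp [hvb])
    have ec : (⟨n₁ + n₂ + 2, by omega⟩ : Fin n) = zc := Fin.ext (by simp [hvc])
    have ed : (⟨n₁ + n₂ + n₃ + 3, by omega⟩ : Fin n) = zd := Fin.ext (by simp [hvd])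
    rw [e0, eb, ec, ed] at key
    exact key

/-- **Surgery, restriction direction**: a pairing of a word pairing `0 ↔ c`, `b ↔ d` restricts
to a pairing of the surgered word with the same vertex count. [folklore] -/
theorem surgery_restrict {n₁ n₂ n₃ n₄ n : ℕ} (hn : n = n₁ + n₂ + n₃ + n₄ + 4)
    (hm : 0 < n₁ + n₂ + n₃ + n₄) (z0 zb zc zd : Fin n) (hv0 : z0.val = 0)
    (hvb : zb.val = n₁ + 1) (hvc : zc.val = n₁ + n₂ + 2) (hvd : zd.val = n₁ + n₂ + n₃ + 3)
    (W : Fin n → α × Bool) (π : Perm (Fin n))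
    (hπ : IsPairingFn W π) (hπ0 : π z0 = zc) (hπb : π zb = zd) :
    ∃ π' : Perm (Fin (n₁ + n₂ + n₃ + n₄)),
      IsPairingFn (W ∘ surgEmb n₁ n₂ n₃ n₄ n hn) π' ∧ vtx n π = vtx (n₁ + n₂ + n₃ + n₄) π' := by
  obtain ⟨hinv, hfp, hlet⟩ := hπ
  have hπc : π zc = z0 := by rw [← hπ0, hinv]
  have hπd : π zd = zb := by rw [← hπb, hinv]
  set e := surgEmb n₁ n₂ n₃ n₄ n hn with he
  have hRval : ∀ x : Fin n, x ∉ Set.range e ↔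
      (x.val = 0 ∨ x.val = n₁ + 1 ∨ x.val = n₁ + n₂ + 2 ∨ x.val = n₁ + n₂ + n₃ + 3) :=
    not_mem_range_surgEmb_iff _ _ _ _ _ hn
  have hπR : ∀ x : Fin n, x ∉ Set.range e → π x ∉ Set.range e := by
    intro x hx
    rw [hRval] at hx ⊢
    rcases hx with h | h | h | h
    · have : x = z0 := Fin.ext (by omega)
      rw [this, hπ0]
      omega
    · have : x = zb := Fin.ext (by omega)
      rw [this, hπb]
      omega
    · have : x = zc := Fin.ext (by omega)
      rw [this, hπc]
      omega
    · have : x = zd := Fin.ext (by omega)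
      rw [this, hπd]
      omega
  have hR : ∀ x, π x ∈ Set.range e ↔ x ∈ Set.range e := by
    intro x
    constructor
    · intro h
      by_contra h'
      exact hπR x h' h
    · intro h
      by_contra h'
      have := hπR (π x) h'
      rw [hinv] at this
      exact this h
  set π' := restrictPerm e (surgEmb_injective _ _ _ _ _ hn) π hR with hπ'
  have hrel : ∀ j, e (π' j) = π (e j) := fun j => apply_restrictPerm _ _ _ _ j
  refine ⟨π', isPairingFn_restrict e _ π hR (fun j => hinv _) (fun j => hfp _) (fun j => hlet _), ?_⟩
  exact vtx_surgery hn hm z0 zb zc zd hv0 hvb hvc hvd π π' hπ0 hπb hπc hπd hrel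

/-- **Surgery, extension direction**: a pairing of the surgered word extends (pairing `0 ↔ c`,
`b ↔ d`) to a pairing of the word with the same vertex count, provided the letters at `c`, `d`
are inverse to those at `0`, `b`. [folklore] -/
theorem surgery_extend {n₁ n₂ n₃ n₄ n : ℕ} (hn : n = n₁ + n₂ + n₃ + n₄ + 4)
    (hm : 0 < n₁ + n₂ + n₃ + n₄) (z0 zb zc zd : Fin n) (hv0 : z0.val = 0)
    (hvb : zb.val = n₁ + 1) (hvc : zc.val = n₁ + n₂ + 2) (hvd : zd.val = n₁ + n₂ + n₃ + 3)
    (W : Fin n → α × Bool) (π' : Perm (Fin (n₁ + n₂ + n₃ + n₄)))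
    (hπ' : IsPairingFn (W ∘ surgEmb n₁ n₂ n₃ n₄ n hn) π')
    (hWc : W zc = linv (W z0)) (hWd : W zd = linv (W zb)) :
    ∃ π : Perm (Fin n), IsPairingFn W π ∧ vtx n π = vtx (n₁ + n₂ + n₃ + n₄) π' := by
  set e := surgEmb n₁ n₂ n₃ n₄ n hn with he
  have hRval : ∀ x : Fin n, x ∉ Set.range e ↔
      (x.val = 0 ∨ x.val = n₁ + 1 ∨ x.val = n₁ + n₂ + 2 ∨ x.val = n₁ + n₂ + n₃ + 3) :=
    not_mem_range_surgEmb_iff _ _ _ _ _ hn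
  set κ : Perm (Fin n) := swap z0 zc * swap zb zd with hκ
  have hκval : ∀ x : Fin n, (κ x).val =
      if x.val = 0 then n₁ + n₂ + 2 else if x.val = n₁ + n₂ + 2 then 0
      else if x.val = n₁ + 1 then n₁ + n₂ + n₃ + 3 else if x.val = n₁ + n₂ + n₃ + 3 then n₁ + 1
      else x.val := by
    intro x
    rw [hκ, Perm.mul_apply, val_swap, val_swap]
    simp only [hv0, hvb, hvc, hvd]
    split_ifs <;> (try contradiction) <;> omega
  have hκe : ∀ j, κ (e j) = e j := by
    intro j
    have hj := (not_mem_range_surgEmb_iff _ _ _ _ _ hn (e j))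
    have hj' : ¬ ((e j).val = 0 ∨ (e j).val = n₁ + 1 ∨ (e j).val = n₁ + n₂ + 2 ∨
        (e j).val = n₁ + n₂ + n₃ + 3) := fun h => (hj.2 h) ⟨j, rfl⟩
    apply Fin.ext
    rw [hκval]
    split_ifs <;> omega
  have hκ0 : κ z0 = zc := Fin.ext (by rw [hκval, if_pos hv0, hvc])
  have hκc : κ zc = z0 := Fin.ext (by rw [hκval]; split_ifs <;> omega)
  have hκb : κ zb = zd := Fin.ext (by rw [hκval]; split_ifs <;> omega)
  have hκd : κ zd = zb := Fin.ext (by rw [hκval]; split_ifs <;> omega)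
  set π : Perm (Fin n) := extendPerm e (surgEmb_injective _ _ _ _ _ hn) π' * κ with hπ
  have hW0 : W z0 = linv (W zc) := by rw [hWc, linv_linv]
  have hWb : W zb = linv (W zd) := by rw [hWd, linv_linv]
  have hpair : IsPairingFn W π := by
    refine isPairingFn_extend e _ π' hπ' κ hκe ?_
    intro x hx
    rw [hRval] at hx
    rcases hx with h | h | h | h
    · have hx : x = z0 := Fin.ext (by omega)
      subst hx
      rw [hκ0]
      refine ⟨?_, hκc, fun h' => ?_, hWc⟩
      · rw [hRval]; omega
      · have := congrArg Fin.val h'; omega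
    · have hx : x = zb := Fin.ext (by omega)
      subst hx
      rw [hκb]
      refine ⟨?_, hκd, fun h' => ?_, hWd⟩
      · rw [hRval]; omega
      · have := congrArg Fin.val h'; omega
    · have hx : x = zc := Fin.ext (by omega)
      subst hx
      rw [hκc]
      refine ⟨?_, hκ0, fun h' => ?_, hW0⟩
      · rw [hRval]; omega
      · have := congrArg Fin.val h'; omega
    · have hx : x = zd := Fin.ext (by omega)
      subst hx
      rw [hκd]
      refine ⟨?_, hκb, fun h' => ?_, hWb⟩
      · rw [hRval]; omega
      · have := congrArg Fin.val h'; omega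
  have hπ0 : π z0 = zc := by
    rw [hπ, Perm.mul_apply, hκ0, extendPerm_apply_of_not_mem]
    rw [hRval]
    omega
  have hπb : π zb = zd := by
    rw [hπ, Perm.mul_apply, hκb, extendPerm_apply_of_not_mem]
    rw [hRval]
    omega
  have hπc : π zc = z0 := by rw [← hπ0, hpair.1]
  have hπd : π zd = zb := by rw [← hπb, hpair.1]
  have hrel : ∀ j, e (π' j) = π (e j) := by
    intro j
    rw [hπ, Perm.mul_apply, hκe, extendPerm_apply]
  exact ⟨π, hpair, vtx_surgery hn hm z0 zb zc zd hv0 hvb hvc hvd π π' hπ0 hπb hπc hπd hrel⟩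

/-! ### Small cycle counts -/

/-- The identity has as many cycles as points. [folklore] -/
theorem ncyc_one {β : Type*} [Fintype β] : ncyc (1 : Perm β) = Fintype.card β := by
  unfold ncyc
  rw [← Nat.card_eq_fintype_card]
  refine Nat.card_congr ⟨Quotient.lift id (fun a b (h : SameCycle 1 a b) => sameCycle_one.1 h),
    fun b => Quotient.mk _ b, fun q => ?_, fun b => rfl⟩
  induction q using Quotient.inductionOn with
  | h a => rfl

/-- A permutation all of whose points lie on one cycle has exactly one cycle. [folklore] -/
theorem ncyc_eq_one_of_sameCycle {β : Type*} [Fintype β] [Nonempty β] (f : Perm β)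
    (h : ∀ x y, f.SameCycle x y) : ncyc f = 1 := by
  unfold ncyc
  haveI : Subsingleton (Quotient (SameCycle.setoid f)) := ⟨fun p q => by
    induction p using Quotient.inductionOn with
    | h a =>
    induction q using Quotient.inductionOn with
    | h b => exact Quotient.sound (h a b)⟩
  haveI : Nonempty (Quotient (SameCycle.setoid f)) := ⟨Quotient.mk _ (Classical.arbitrary β)⟩
  exact Nat.card_unique

/-- A word carrying a pairing has even length. [folklore] -/
theorem two_dvd_of_isPairingFn {n : ℕ} {W : Fin n → α × Bool} {π : Perm (Fin n)}
    (h : IsPairingFn W π) : 2 ∣ n := by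
  have hsq : π ^ 2 = 1 := by
    ext i
    simp [sq, Perm.mul_apply, h.1 i]
  have hsupp : π.support = Finset.univ := by
    ext i
    simp [Perm.mem_support, h.2.1 i]
  have := two_dvd_card_support hsq
  rwa [hsupp, Finset.card_univ, Fintype.card_fin] at this

/-- The vertex count of the commutator word `X Y X⁻¹ Y⁻¹` of length four is one. [folklore] -/
theorem vtx_four (π : Perm (Fin 4)) (h0 : π 0 = 2) (h2 : π 2 = 0) (h3 : π 3 = 1) :
    vtx 4 π = 1 := by
  unfold vtx
  set τ := finRotate 4 * π with hτ
  have t0 : τ 0 = 3 := by rw [hτ, Perm.mul_apply, h0]; decide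
  have t3 : τ 3 = 2 := by rw [hτ, Perm.mul_apply, h3]; decide
  have t2 : τ 2 = 1 := by rw [hτ, Perm.mul_apply, h2]; decide
  have h03 : τ.SameCycle 0 3 := ⟨1, by rw [zpow_one, t0]⟩
  have h02 : τ.SameCycle 0 2 :=
    ⟨2, by rw [show (2 : ℤ) = ((2 : ℕ) : ℤ) from rfl, zpow_natCast, sq, Perm.mul_apply, t0, t3]⟩
  have h01 : τ.SameCycle 0 1 :=
    ⟨3, by rw [show (3 : ℤ) = ((3 : ℕ) : ℤ) from rfl, zpow_natCast, pow_succ, pow_two, Perm.mul_apply,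
      Perm.mul_apply, t0, t3, t2]⟩
  have h0x : ∀ x : Fin 4, τ.SameCycle 0 x := by
    intro x
    fin_cases x
    · exact SameCycle.refl _ _
    · exact h01
    · exact h02
    · exact h03
  exact ncyc_eq_one_of_sameCycle τ fun x y => (h0x x).symm.trans (h0x y)

/-! ### Crossing or adjacent pairs -/

/-- **A fixed-point-free involution of `Fin n` has an adjacent pair or two crossing pairs**: either
some `i` is paired with `i + 1`, or there are `i < j < π i < π j` (take a pair `i < π i` of
minimal width; if it is not adjacent, the partner of `i + 1` leaves the interval). [folklore] -/
theorem exists_adjacent_or_crossing {n : ℕ} (π : Perm (Fin n)) (hinv : ∀ i, π (π i) = i)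
    (hfp : ∀ i, π i ≠ i) (hn : 0 < n) :
    (∃ i : Fin n, (π i).val = i.val + 1) ∨
      ∃ i j : Fin n, i.val < j.val ∧ j.val < (π i).val ∧ (π i).val < (π j).val := by
  classical
  set S : Finset (Fin n) := Finset.univ.filter fun i => i.val < (π i).val with hS
  have hmem : ∀ x : Fin n, x ∈ S ↔ x.val < (π x).val := fun x => by
    rw [hS, Finset.mem_filter]
    simp
  have hSne : S.Nonempty := by
    have i : Fin n := ⟨0, hn⟩
    rcases Nat.lt_or_ge i.val (π i).val with h | h
    · exact ⟨i, (hmem i).2 h⟩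
    · refine ⟨π i, (hmem _).2 ?_⟩
      rw [hinv]
      have : (π i).val ≠ i.val := fun h' => hfp i (Fin.ext h')
      omega
  obtain ⟨i, hiS, hmin⟩ := Finset.exists_min_image S (fun i => (π i).val - i.val) hSne
  have hi : i.val < (π i).val := (hmem i).1 hiS
  by_cases hadj : (π i).val = i.val + 1
  · exact Or.inl ⟨i, hadj⟩
  right
  have hlt : i.val + 1 < (π i).val := by omega
  set k : Fin n := ⟨i.val + 1, by omega⟩ with hk
  have hkv : k.val = i.val + 1 := rfl
  have hπk : π k ≠ k := hfp k
  rcases Nat.lt_or_ge (π i).val (π k).val with h1 | h1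
  · exact ⟨i, k, by omega, by omega, h1⟩
  rcases Nat.lt_or_ge (π k).val i.val with h2 | h2
  · refine ⟨π k, i, h2, ?_, ?_⟩
    · rw [hinv]; omega
    · rw [hinv]; omega
  -- now `i ≤ π k ≤ π i`
  exfalso
  have hne1 : (π k).val ≠ i.val := by
    intro h
    have : π k = i := Fin.ext h
    have : π i = k := by rw [← this, hinv]
    exact hadj (by rw [this])
  have hne2 : (π k).val ≠ (π i).val := by
    intro h
    have : k = i := π.injective (Fin.ext h)
    have := congrArg Fin.val this
    omega
  have hne3 : (π k).val ≠ k.val := fun h => hπk (Fin.ext h)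
  rcases Nat.lt_or_ge k.val (π k).val with h3 | h3
  · have hkS : k ∈ S := (hmem k).2 h3
    have := hmin k hkS
    omega
  · omega

/-! ### Free group and list helpers -/

/-- A cancelling pair may be removed. [folklore] -/
theorem mk_append_pair (p s : List (α × Bool)) (x : α × Bool) :
    FreeGroup.mk (p ++ x :: linv x :: s) = FreeGroup.mk (p ++ s) := by
  have h := @FreeGroup.Red.Step.not α p s x.1 x.2
  exact Quot.sound h

/-- `invRev` of a cons. [folklore] -/
theorem invRev_cons (x : α × Bool) (L : List (α × Bool)) :
    FreeGroup.invRev (x :: L) = FreeGroup.invRev L ++ [linv x] := by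
  simp [FreeGroup.invRev, linv]

/-- The letter `x⁻¹` represents the inverse of the letter `x`. [folklore] -/
theorem mk_linv (x : α × Bool) : FreeGroup.mk [linv x] = (FreeGroup.mk [x])⁻¹ := by
  rw [FreeGroup.inv_mk]
  rfl

/-- Rotating a word conjugates the element it represents. [folklore] -/
theorem mk_rotate (l : List (α × Bool)) (k : ℕ) :
    FreeGroup.mk (l.rotate k) =
      (FreeGroup.mk (l.take (k % l.length)))⁻¹ * FreeGroup.mk l *
        FreeGroup.mk (l.take (k % l.length)) := by
  have hmid : FreeGroup.mk l =
      FreeGroup.mk (l.take (k % l.length)) * FreeGroup.mk (l.drop (k % l.length)) := by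
    rw [FreeGroup.mul_mk, List.take_append_drop]
  rw [List.rotate_eq_drop_append_take_mod, ← FreeGroup.mul_mk, hmid]
  group

/-- A list with two marked consecutive positions. [folklore] -/
theorem list_eq_take_cons_cons_drop {β : Type*} (l : List β) (k : ℕ) (hk : k + 2 ≤ l.length) :
    l = l.take k ++ l[k]'(by omega) :: l[k + 1]'(by omega) :: l.drop (k + 2) := by
  conv_lhs => rw [← List.take_append_drop k l, List.drop_eq_getElem_cons (by omega : k < l.length),
    List.drop_eq_getElem_cons (by omega : k + 1 < l.length)]

/-- The word `W ∘ skip2 m k` as a list: the positions `k, k+1` deleted. [folklore] -/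
theorem ofFn_comp_skip2 {β : Type*} {m k : ℕ} (hk : k ≤ m) (W : Fin (m + 2) → β) :
    List.ofFn (W ∘ skip2 m k) = (List.ofFn W).take k ++ (List.ofFn W).drop (k + 2) := by
  have hlen : ((List.ofFn W).take k).length = k := by
    simp
    omega
  apply List.ext_get
  · simp
    omega
  · intro i h₁ h₂
    rw [List.get_eq_getElem, List.get_eq_getElem, List.getElem_ofFn]
    simp only [Function.comp_apply]
    by_cases h : i < k
    · rw [List.getElem_append_left (by rw [hlen]; exact h), List.getElem_take, List.getElem_ofFn]
      congr 1
      exact Fin.ext (by rw [val_skip2, if_pos h])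
    · rw [List.getElem_append_right (by rw [hlen]; omega), List.getElem_drop, List.getElem_ofFn]
      congr 1
      apply Fin.ext
      rw [val_skip2, if_neg h]
      simp only [hlen]
      omega

/-- A list with four marked positions `0, n₁ + 1, n₁ + n₂ + 2, n₁ + n₂ + n₃ + 3` and the blocks
between them. [folklore] -/
theorem list_eq_blocks {β : Type*} (l : List β) (n₁ n₂ n₃ n₄ : ℕ)
    (hl : l.length = n₁ + n₂ + n₃ + n₄ + 4) :
    l = l[0]'(by omega) :: ((l.drop 1).take n₁ ++ l[n₁ + 1]'(by omega) ::
      ((l.drop (n₁ + 2)).take n₂ ++ l[n₁ + n₂ + 2]'(by omega) ::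
        ((l.drop (n₁ + n₂ + 3)).take n₃ ++ l[n₁ + n₂ + n₃ + 3]'(by omega) ::
          l.drop (n₁ + n₂ + n₃ + 4)))) := by
  have e0 : l = l[0]'(by omega) :: l.drop 1 := by
    conv_lhs => rw [← List.drop_zero (l := l), List.drop_eq_getElem_cons (by omega : 0 < l.length)]
  have e1 : l.drop 1 = (l.drop 1).take n₁ ++ l.drop (n₁ + 1) := by
    conv_lhs => rw [← List.take_append_drop n₁ (l.drop 1), List.drop_drop]
    congr 2
    omega
  have e2 : l.drop (n₁ + 1) = l[n₁ + 1]'(by omega) :: l.drop (n₁ + 2) :=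
    List.drop_eq_getElem_cons (by omega)
  have e3 : l.drop (n₁ + 2) = (l.drop (n₁ + 2)).take n₂ ++ l.drop (n₁ + n₂ + 2) := by
    conv_lhs => rw [← List.take_append_drop n₂ (l.drop (n₁ + 2)), List.drop_drop]
    congr 2
    omega
  have e4 : l.drop (n₁ + n₂ + 2) = l[n₁ + n₂ + 2]'(by omega) :: l.drop (n₁ + n₂ + 3) :=
    List.drop_eq_getElem_cons (by omega)
  have e5 : l.drop (n₁ + n₂ + 3) = (l.drop (n₁ + n₂ + 3)).take n₃ ++ l.drop (n₁ + n₂ + n₃ + 3) := by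
    conv_lhs => rw [← List.take_append_drop n₃ (l.drop (n₁ + n₂ + 3)), List.drop_drop]
    congr 2
    omega
  have e6 : l.drop (n₁ + n₂ + n₃ + 3) = l[n₁ + n₂ + n₃ + 3]'(by omega) :: l.drop (n₁ + n₂ + n₃ + 4) :=
    List.drop_eq_getElem_cons (by omega)
  conv_lhs => rw [e0, e1, e2, e3, e4, e5, e6]

/-- The surgered word `W ∘ surgEmb` as a list: the blocks `U₃ U₂ U₁ U₄`. [folklore] -/
theorem ofFn_comp_surgEmb {β : Type*} {n₁ n₂ n₃ n₄ n : ℕ} (hn : n = n₁ + n₂ + n₃ + n₄ + 4)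
    (W : Fin n → β) :
    List.ofFn (W ∘ surgEmb n₁ n₂ n₃ n₄ n hn) =
      ((List.ofFn W).drop (n₁ + n₂ + 3)).take n₃ ++ ((List.ofFn W).drop (n₁ + 2)).take n₂ ++
        ((List.ofFn W).drop 1).take n₁ ++ (List.ofFn W).drop (n₁ + n₂ + n₃ + 4) := by
  have lA : (((List.ofFn W).drop (n₁ + n₂ + 3)).take n₃).length = n₃ := by
    rw [List.length_take, List.length_drop, List.length_ofFn, Nat.min_eq_left (by omega)]
  have lB : (((List.ofFn W).drop (n₁ + 2)).take n₂).length = n₂ := by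
    rw [List.length_take, List.length_drop, List.length_ofFn, Nat.min_eq_left (by omega)]
  have lC : (((List.ofFn W).drop 1).take n₁).length = n₁ := by
    rw [List.length_take, List.length_drop, List.length_ofFn, Nat.min_eq_left (by omega)]
  have lAB : (((List.ofFn W).drop (n₁ + n₂ + 3)).take n₃ ++
      ((List.ofFn W).drop (n₁ + 2)).take n₂).length = n₃ + n₂ := by
    rw [List.length_append, lA, lB]
  have lABC : (((List.ofFn W).drop (n₁ + n₂ + 3)).take n₃ ++
      ((List.ofFn W).drop (n₁ + 2)).take n₂ ++ ((List.ofFn W).drop 1).take n₁).length =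
        n₃ + n₂ + n₁ := by
    rw [List.length_append, lAB, lC]
  apply List.ext_get
  · simp only [List.length_ofFn, List.length_append, lABC, List.length_drop]
    omega
  · intro i h₁ h₂
    rw [List.get_eq_getElem, List.get_eq_getElem, List.getElem_ofFn]
    simp only [Function.comp_apply]
    have hi : i < n₁ + n₂ + n₃ + n₄ := by simpa using h₁
    have hval := val_surgEmb n₁ n₂ n₃ n₄ n hn ⟨i, hi⟩
    simp only at hval
    by_cases ha : i < n₃
    · rw [if_pos ha] at hval
      rw [List.getElem_append_left (by rw [lABC]; omega),
        List.getElem_append_left (by rw [lAB]; omega),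
        List.getElem_append_left (by rw [lA]; omega), List.getElem_take, List.getElem_drop,
        List.getElem_ofFn]
      congr 1
      exact Fin.ext hval
    by_cases hb : i < n₃ + n₂
    · rw [if_neg ha, if_pos hb] at hval
      rw [List.getElem_append_left (by rw [lABC]; omega),
        List.getElem_append_left (by rw [lAB]; omega),
        List.getElem_append_right (by rw [lA]; omega), List.getElem_take, List.getElem_drop,
        List.getElem_ofFn]
      congr 1
      exact Fin.ext (by rw [hval]; dsimp only; rw [lA])
    by_cases hc : i < n₃ + n₂ + n₁
    · rw [if_neg ha, if_neg hb, if_pos hc] at hval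
      rw [List.getElem_append_left (by rw [lABC]; omega),
        List.getElem_append_right (by rw [lAB]; omega), List.getElem_take,
        List.getElem_drop, List.getElem_ofFn]
      congr 1
      exact Fin.ext (by rw [hval]; dsimp only; rw [lAB]; omega)
    · rw [if_neg ha, if_neg hb, if_neg hc] at hval
      rw [List.getElem_append_right (by rw [lABC]; omega), List.getElem_drop, List.getElem_ofFn]
      congr 1
      exact Fin.ext (by rw [hval]; dsimp only; rw [lABC]; omega)

/-- Transport of pairings between a list and a function enumerating it. [folklore] -/
theorem transfer_pairing {n : ℕ} {l : List (α × Bool)} (h : l.length = n) {F : Fin n → α × Bool}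
    (hF : ∀ i : Fin n, F i = l.get (Fin.cast h.symm i)) :
    (∀ π : Perm (Fin l.length), IsPairingFn l.get π →
        ∃ π' : Perm (Fin n), IsPairingFn F π' ∧ vtx n π' = vtx l.length π) ∧
      (∀ π' : Perm (Fin n), IsPairingFn F π' →
        ∃ π : Perm (Fin l.length), IsPairingFn l.get π ∧ vtx l.length π = vtx n π') := by
  subst h
  have hF' : F = l.get := funext fun i => by rw [hF]; rfl
  subst hF'
  exact ⟨fun π hπ => ⟨π, hπ, rfl⟩, fun π hπ => ⟨π, hπ, rfl⟩⟩

/-- **A paired word lies in the commutator subgroup**: the pairing matches the occurrences of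
each letter with those of its inverse. [folklore] -/
theorem mk_ofFn_mem_commutator {n : ℕ} {W : Fin n → α × Bool} {π : Perm (Fin n)}
    (h : IsPairingFn W π) : FreeGroup.mk (List.ofFn W) ∈ commutator (FreeGroup α) := by
  classical
  rw [mk_mem_commutator_iff_count]
  intro a
  rw [count_ofFn, count_ofFn]
  refine Finset.card_bij (fun i _ => π i) (fun i hi => ?_) (fun i _ j _ hij => ?_) (fun j hj => ?_)
  · simp only [Finset.mem_filter, Finset.mem_univ, true_and] at hi ⊢
    rw [h.2.2, hi]
    rfl
  · exact π.injective hij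
  · simp only [Finset.mem_filter, Finset.mem_univ, true_and] at hj
    refine ⟨π j, ?_, h.1 j⟩
    simp only [Finset.mem_filter, Finset.mem_univ, true_and]
    rw [h.2.2, hj]
    rfl

end Words

/-! ### Commutator length: one more commutator (conjugation invariance and attainment are
`commutatorLength_conj`, `exists_list_length_eq_commutatorLength` of `RandomSclFreeGroupProofs.lean`) -/

section Cl

variable {G : Type*} [Group G]

/-- Multiplying by one commutator raises the commutator length by at most one. [folklore] -/
theorem commutatorLength_commutator_mul_le (a b g : G) (hg : g ∈ commutator G) :
    commutatorLength (a * b * a⁻¹ * b⁻¹ * g) ≤ commutatorLength g + 1 := by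
  obtain ⟨l, hl, hprod⟩ := exists_list_length_eq_commutatorLength hg
  have := commutatorLength_le_of_prod_eq ((a, b) :: l) (g := a * b * a⁻¹ * b⁻¹ * g)
    (by simp [hprod])
  simpa [hl] using this

/-- **The cut-and-paste identity** behind the handle surgery: for any elements,
`x w₂ y w₃ x⁻¹ w₄ y⁻¹ w₅ = [x w₃⁻¹ w₄⁻¹, w₄ w₃ w₂ y w₄⁻¹] · (w₄ w₃ w₂ w₅)`
(cf. the interchange identity of [Heuer2020, Thm 2.6], after Fialkovski–Ivanov). [folklore] -/
theorem handle_identity (x y w₂ w₃ w₄ w₅ : G) :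
    x * w₂ * y * w₃ * x⁻¹ * w₄ * y⁻¹ * w₅ =
      (x * w₃⁻¹ * w₄⁻¹) * (w₄ * w₃ * w₂ * y * w₄⁻¹) * (x * w₃⁻¹ * w₄⁻¹)⁻¹ *
        (w₄ * w₃ * w₂ * y * w₄⁻¹)⁻¹ * (w₄ * w₃ * w₂ * w₅) := by
  group

end Cl

/-! ### The upper bound: a pairing of genus `g` yields `g` commutators -/

section UpperBound

variable {α : Type*}

/-- `mk (x :: l) = mk [x] * mk l`. [folklore] -/
theorem mk_cons_eq (x : α × Bool) (l : List (α × Bool)) :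
    FreeGroup.mk (x :: l) = FreeGroup.mk [x] * FreeGroup.mk l := by
  rw [FreeGroup.mul_mk]
  rfl

/-- The vertex count of the word `x x⁻¹` is two. [folklore] -/
theorem vtx_two (π : Perm (Fin 2)) (h0 : π 0 = 1) (h1 : π 1 = 0) : vtx 2 π = 2 := by
  unfold vtx
  have : finRotate 2 * π = 1 := by
    ext x
    fin_cases x
    · simp [Perm.mul_apply, h0]
    · simp [Perm.mul_apply, h1]
  rw [this, ncyc_one, Fintype.card_fin]

/-- **Upper bound (Culler's construction).** A word of length `n ≥ 1` carrying a pairing `π` with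
`v` vertices represents a product of at most `(n/2 + 1 - v)/2` commutators:
`2 cl + v ≤ n/2 + 1`. Induction: fold an adjacent cancelling pair (Part `fold_at`), or cut a
handle along two crossing pairs (`surgery_restrict` and `handle_identity`). [cite: Heuer2020, Thm 2.4] -/
theorem two_mul_commutatorLength_add_vtx_le (n : ℕ) :
    ∀ (W : Fin n → α × Bool) (π : Perm (Fin n)), IsPairingFn W π → 0 < n →
      2 * commutatorLength (FreeGroup.mk (List.ofFn W)) + vtx n π ≤ n / 2 + 1 := by
  induction n using Nat.strong_induction_on with
  | _ n IH =>
  intro W π hπ hn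
  obtain ⟨hinv, hfp, hlet⟩ := hπ
  rcases exists_adjacent_or_crossing π hinv hfp hn with ⟨i, hi⟩ | ⟨i, j, hij, hjπ, hππ⟩
  · -- an adjacent pair `(i, i + 1)`: fold it
    have hi2 := (π i).isLt
    obtain ⟨m, rfl⟩ : ∃ m, n = m + 2 := ⟨n - 2, by omega⟩
    have hk' : i.val ≤ m := by omega
    have hik : i = ⟨i.val, by omega⟩ := Fin.ext rfl
    have hπi : π i = ⟨i.val + 1, by omega⟩ := Fin.ext hi
    have hkk : W ⟨i.val + 1, by omega⟩ = linv (W ⟨i.val, by omega⟩) := by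
      rw [← hπi, hlet, ← hik]
    have hlist : FreeGroup.mk (List.ofFn W) = FreeGroup.mk (List.ofFn (W ∘ skip2 m i.val)) := by
      rw [ofFn_comp_skip2 hk' W]
      have h2 : i.val + 2 ≤ (List.ofFn W).length := by simp; omega
      conv_lhs => rw [list_eq_take_cons_cons_drop (List.ofFn W) i.val h2]
      simp only [List.getElem_ofFn]
      rw [show W ⟨i.val + 1, _⟩ = linv (W ⟨i.val, _⟩) from hkk]
      exact mk_append_pair _ _ _
    rcases Nat.eq_zero_or_pos m with hm | hm
    · -- `n = 2`: the word is `x x⁻¹`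
      subst hm
      have hi0 : i.val = 0 := by omega
      have hπ0 : π 0 = 1 := by
        have : (0 : Fin (0 + 2)) = i := Fin.ext (by simp [hi0])
        rw [this, hπi]
        exact Fin.ext (by simp [hi0])
      have hπ1 : π 1 = 0 := by rw [← hπ0, hinv]
      have hv : vtx (0 + 2) π = 2 := vtx_two π hπ0 hπ1
      have h1 : FreeGroup.mk (List.ofFn W) = 1 := by
        rw [hlist, List.ofFn_zero]
        rfl
      rw [h1, commutatorLength_one, hv]
    · obtain ⟨π', hπ', hle⟩ := fold_at hm hk' W π ⟨hinv, hfp, hlet⟩ hkk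
      have ih := IH m (by omega) (W ∘ skip2 m i.val) π' hπ' hm
      rw [hlist]
      omega
  · -- two crossing pairs `i < j < π i < π j`: rotate `i` to the front and cut the handle
    have hπi := (π i).isLt
    have hπj := (π j).isLt
    set k := i.val with hk
    set ρ : Perm (Fin n) := (finRotate n) ^ k with hρ
    set W₂ : Fin n → α × Bool := W ∘ ⇑ρ with hW₂
    set π₂ : Perm (Fin n) := ρ⁻¹ * π * ρ with hπ₂
    have hpair₂ : IsPairingFn W₂ π₂ := isPairingFn_rotate ⟨hinv, hfp, hlet⟩ k
    have hv₂ : vtx n π₂ = vtx n π := vtx_rotate n π k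
    have hcl₂ : commutatorLength (FreeGroup.mk (List.ofFn W₂)) =
        commutatorLength (FreeGroup.mk (List.ofFn W)) := by
      rw [hW₂, hρ, ofFn_comp_finRotate_pow, mk_rotate]
      have := commutatorLength_conj (FreeGroup.mk (List.ofFn W))
        (FreeGroup.mk ((List.ofFn W).take (k % (List.ofFn W).length)))⁻¹
      rwa [inv_inv] at this
    -- the four positions after rotation
    set b := j.val - k with hb
    set c := (π i).val - k with hc
    set d := (π j).val - k with hd
    have hρv : ∀ (t : ℕ) (ht : t + k < n), ρ ⟨t, by omega⟩ = ⟨t + k, ht⟩ := by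
      intro t ht
      apply Fin.ext
      rw [hρ, val_finRotate_pow]
      exact Nat.mod_eq_of_lt ht
    have hρ0 : ρ ⟨0, hn⟩ = i := by rw [hρv 0 (by omega)]; exact Fin.ext (by simp [hk])
    have hρb : ρ ⟨b, by omega⟩ = j := by rw [hρv b (by omega)]; exact Fin.ext (by simp [hb]; omega)
    have hρc : ρ ⟨c, by omega⟩ = π i := by rw [hρv c (by omega)]; exact Fin.ext (by simp [hc]; omega)
    have hρd : ρ ⟨d, by omega⟩ = π j := by rw [hρv d (by omega)]; exact Fin.ext (by simp [hd]; omega)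
    have hπ₂0 : π₂ ⟨0, hn⟩ = ⟨c, by omega⟩ := by
      rw [hπ₂, Perm.mul_apply, Perm.mul_apply, hρ0, Perm.inv_eq_iff_eq, hρc]
    have hπ₂b : π₂ ⟨b, by omega⟩ = ⟨d, by omega⟩ := by
      rw [hπ₂, Perm.mul_apply, Perm.mul_apply, hρb, Perm.inv_eq_iff_eq, hρd]
    have hπ₂c : π₂ ⟨c, by omega⟩ = ⟨0, hn⟩ := by rw [← hπ₂0, hpair₂.1]
    have hπ₂d : π₂ ⟨d, by omega⟩ = ⟨b, by omega⟩ := by rw [← hπ₂b, hpair₂.1]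
    have hWc : W₂ ⟨c, by omega⟩ = linv (W₂ ⟨0, hn⟩) := by rw [← hπ₂0, hpair₂.2.2]
    have hWd : W₂ ⟨d, by omega⟩ = linv (W₂ ⟨b, by omega⟩) := by rw [← hπ₂b, hpair₂.2.2]
    have hn' : n = (b - 1) + (c - b - 1) + (d - c - 1) + (n - d - 1) + 4 := by omega
    -- the list of the rotated word, cut into blocks
    set l := List.ofFn W₂ with hl
    have hll : l.length = (b - 1) + (c - b - 1) + (d - c - 1) + (n - d - 1) + 4 := by
      rw [hl, List.length_ofFn]
      exact hn'
    have hblocks := list_eq_blocks l (b - 1) (c - b - 1) (d - c - 1) (n - d - 1) hll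
    have g0 : l[0]'(by omega) = W₂ ⟨0, hn⟩ := by simp [hl]
    have gb : l[b - 1 + 1]'(by omega) = W₂ ⟨b, by omega⟩ := by
      simp only [hl, List.getElem_ofFn]
      congr 1
      exact Fin.ext (by simp; omega)
    have gc : l[b - 1 + (c - b - 1) + 2]'(by omega) = linv (W₂ ⟨0, hn⟩) := by
      rw [← hWc]
      simp only [hl, List.getElem_ofFn]
      congr 1
      exact Fin.ext (by simp; omega)
    have gd : l[b - 1 + (c - b - 1) + (d - c - 1) + 3]'(by omega) = linv (W₂ ⟨b, by omega⟩) := by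
      rw [← hWd]
      simp only [hl, List.getElem_ofFn]
      congr 1
      exact Fin.ext (by simp; omega)
    rw [g0, gb, gc, gd] at hblocks
    rcases Nat.eq_zero_or_pos ((b - 1) + (c - b - 1) + (d - c - 1) + (n - d - 1)) with hm0 | hm
    · -- `n = 4`: the word is a single commutator `X Y X⁻¹ Y⁻¹`
      have hn4 : n = 4 := by omega
      subst hn4
      have hb1 : b = 1 := by omega
      have hc2 : c = 2 := by omega
      have hd3 : d = 3 := by omega
      have e0 : π₂ 0 = 2 := by
        have h := hπ₂0
        have e : (⟨c, by omega⟩ : Fin 4) = 2 := Fin.ext (by simp [hc2])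
        rw [e] at h
        exact h
      have e1 : π₂ 1 = 3 := by
        have h := hπ₂b
        have e : (⟨b, by omega⟩ : Fin 4) = 1 := Fin.ext (by simp [hb1])
        have e' : (⟨d, by omega⟩ : Fin 4) = 3 := Fin.ext (by simp [hd3])
        rw [e, e'] at h
        exact h
      have e2 : π₂ 2 = 0 := by rw [← e0, hpair₂.1]
      have e3 : π₂ 3 = 1 := by rw [← e1, hpair₂.1]
      have hvtx : vtx 4 π₂ = 1 := vtx_four π₂ e0 e2 e3
      have hlist : l = [W₂ ⟨0, hn⟩, W₂ ⟨b, by omega⟩, linv (W₂ ⟨0, hn⟩), linv (W₂ ⟨b, by omega⟩)] := by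
        rw [hblocks]
        simp [hb1, hc2, hd3, hl]
      have hcl : commutatorLength (FreeGroup.mk l) ≤ 1 := by
        rw [hlist]
        change commutatorLength (FreeGroup.mk ([W₂ ⟨0, hn⟩] ++ [W₂ ⟨b, by omega⟩] ++
          [linv (W₂ ⟨0, hn⟩)] ++ [linv (W₂ ⟨b, by omega⟩)])) ≤ 1
        simp only [← FreeGroup.mul_mk, mk_linv]
        exact commutatorLength_commutatorElement_le _ _
      rw [← hcl₂, ← hv₂, hvtx]
      change 2 * commutatorLength (FreeGroup.mk l) + 1 ≤ 4 / 2 + 1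
      omega
    · -- `n > 4`: surgery
      obtain ⟨π', hπ', hv'⟩ := surgery_restrict hn' hm ⟨0, hn⟩ ⟨b, by omega⟩ ⟨c, by omega⟩
        ⟨d, by omega⟩ rfl (by simp; omega) (by simp; omega) (by simp; omega) W₂ π₂ hpair₂ hπ₂0 hπ₂b
      have ih := IH _ (by omega) (W₂ ∘ surgEmb (b - 1) (c - b - 1) (d - c - 1) (n - d - 1) n hn')
        π' hπ' hm
      have hmem := mk_ofFn_mem_commutator hπ'
      rw [ofFn_comp_surgEmb hn' W₂] at ih hmem
      -- the handle identity
      set U₁ := (l.drop 1).take (b - 1) with hU₁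
      set U₂ := (l.drop (b - 1 + 2)).take (c - b - 1) with hU₂
      set U₃ := (l.drop (b - 1 + (c - b - 1) + 3)).take (d - c - 1) with hU₃
      set U₄ := l.drop (b - 1 + (c - b - 1) + (d - c - 1) + 4) with hU₄
      have hl' : l = [W₂ ⟨0, hn⟩] ++ U₁ ++ [W₂ ⟨b, by omega⟩] ++ U₂ ++ [linv (W₂ ⟨0, hn⟩)] ++ U₃ ++
          [linv (W₂ ⟨b, by omega⟩)] ++ U₄ := by
        rw [hblocks]
        simp
      have hmk : FreeGroup.mk l =
          FreeGroup.mk [W₂ ⟨0, hn⟩] * FreeGroup.mk U₁ * FreeGroup.mk [W₂ ⟨b, by omega⟩] *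
            FreeGroup.mk U₂ * (FreeGroup.mk [W₂ ⟨0, hn⟩])⁻¹ * FreeGroup.mk U₃ *
              (FreeGroup.mk [W₂ ⟨b, by omega⟩])⁻¹ * FreeGroup.mk U₄ := by
        conv_lhs => rw [hl']
        simp only [← FreeGroup.mul_mk, mk_linv]
      rw [handle_identity] at hmk
      have hmk' : FreeGroup.mk (U₃ ++ U₂ ++ U₁ ++ U₄) =
          FreeGroup.mk U₃ * FreeGroup.mk U₂ * FreeGroup.mk U₁ * FreeGroup.mk U₄ := by
        simp only [← FreeGroup.mul_mk]
      have hcl : commutatorLength (FreeGroup.mk l) ≤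
          commutatorLength (FreeGroup.mk (U₃ ++ U₂ ++ U₁ ++ U₄)) + 1 := by
        rw [hmk, ← hmk']
        exact commutatorLength_commutator_mul_le _ _ _ hmem
      rw [← hcl₂, ← hv₂, hv']
      change 2 * commutatorLength (FreeGroup.mk l) + _ ≤ _
      omega

end UpperBound

/-! ### The lower bound: `g` commutators yield a pairing of genus `≤ g` -/

section LowerBound

variable {α : Type*}

/-- The list `p ++ y :: y⁻¹ :: s` enumerated: it is `insert2 |p| y` of `p ++ s`. [folklore] -/
theorem get_append_pair (p s : List (α × Bool)) (y : α × Bool)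
    (h : (p ++ y :: linv y :: s).length = (p ++ s).length + 2) (i : Fin ((p ++ s).length + 2)) :
    insert2 p.length (by simp) y (p ++ s).get i = (p ++ y :: linv y :: s).get (Fin.cast h.symm i) := by
  rw [List.get_eq_getElem]
  simp only [Fin.val_cast]
  unfold insert2
  split_ifs with h₁ h₂ h₃
  · rw [List.get_eq_getElem]
    dsimp only
    rw [List.getElem_append_left (by simpa using h₁), List.getElem_append_left h₁]
  · rw [List.getElem_append_right (by omega)]
    simp [h₂]
  · rw [List.getElem_append_right (by omega)]
    simp [h₃]
  · rw [List.get_eq_getElem]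
    dsimp only
    rw [List.getElem_append_right (show p.length ≤ i.val - 2 by omega),
      List.getElem_append_right (show p.length ≤ i.val by omega), List.getElem_cons,
      dif_neg (by omega), List.getElem_cons, dif_neg (by omega)]
    congr 1
    omega

/-- Transport of a pairing-with-bound statement along an equality of lists. [folklore] -/
theorem pairing_congr {l₁ l₂ : List (α × Bool)} (e : l₁ = l₂) (K : ℕ)
    (h : ∃ π : Perm (Fin l₁.length), IsPairingFn l₁.get π ∧ l₁.length / 2 + 1 ≤ K + vtx l₁.length π) :
    ∃ π : Perm (Fin l₂.length), IsPairingFn l₂.get π ∧ l₂.length / 2 + 1 ≤ K + vtx l₂.length π := by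
  subst e
  exact h

/-- **Deleting a cancelling pair** from a paired list leaves a paired list with at most one
vertex fewer. [folklore] -/
theorem pairing_delete (p s : List (α × Bool)) (y : α × Bool) (hne : p ++ s ≠ [])
    (π : Perm (Fin (p ++ y :: linv y :: s).length)) (hπ : IsPairingFn (p ++ y :: linv y :: s).get π) :
    ∃ π' : Perm (Fin (p ++ s).length), IsPairingFn (p ++ s).get π' ∧
      vtx (p ++ y :: linv y :: s).length π ≤ vtx (p ++ s).length π' + 1 := by
  have hm1 : 1 ≤ (p ++ s).length := List.length_pos_of_ne_nil hne
  have hk : p.length ≤ (p ++ s).length := by simp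
  have hlen : (p ++ y :: linv y :: s).length = (p ++ s).length + 2 := by
    simp only [List.length_append, List.length_cons]
    omega
  obtain ⟨πF, hπF, hvF⟩ := (transfer_pairing hlen (F := insert2 p.length hk y (p ++ s).get)
    (fun i => get_append_pair p s y hlen i)).1 π hπ
  have hkk : insert2 p.length hk y (p ++ s).get ⟨p.length + 1, by omega⟩ =
      linv (insert2 p.length hk y (p ++ s).get ⟨p.length, by omega⟩) := by
    rw [insert2_apply_self hk, insert2_apply_succ hk]
  obtain ⟨π', hπ', hle⟩ := fold_at hm1 hk _ πF hπF hkk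
  have hcomp : insert2 p.length hk y (p ++ s).get ∘ skip2 (p ++ s).length p.length = (p ++ s).get :=
    funext fun j => insert2_skip2 hk y _ j
  rw [hcomp] at hπ'
  exact ⟨π', hπ', by omega⟩

/-- **Inserting a cancelling pair** into a paired nonempty list gives a paired list with one
vertex more. [folklore] -/
theorem pairing_insert (p s : List (α × Bool)) (y : α × Bool) (hne : p ++ s ≠ [])
    (π : Perm (Fin (p ++ s).length)) (hπ : IsPairingFn (p ++ s).get π) :
    ∃ π' : Perm (Fin (p ++ y :: linv y :: s).length), IsPairingFn (p ++ y :: linv y :: s).get π' ∧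
      vtx (p ++ y :: linv y :: s).length π' = vtx (p ++ s).length π + 1 := by
  have hm1 : 1 ≤ (p ++ s).length := List.length_pos_of_ne_nil hne
  have hk : p.length ≤ (p ++ s).length := by simp
  have hlen : (p ++ y :: linv y :: s).length = (p ++ s).length + 2 := by
    simp only [List.length_append, List.length_cons]
    omega
  obtain ⟨hI, hvI⟩ := unfold_at hm1 hk (p ++ s).get π hπ y
  obtain ⟨π', hπ', hv'⟩ := (transfer_pairing hlen (F := insert2 p.length hk y (p ++ s).get)
    (fun i => get_append_pair p s y hlen i)).2 _ hI
  exact ⟨π', hπ', by rw [hv', hvI]⟩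

/-- **Free reduction does not increase the genus**: along `FreeGroup.Red`, a pairing with
`|L|/2 + 1 ≤ K + v` descends to the (nonempty) reduced word. [folklore] -/
theorem pairing_of_red {L₁ L₂ : List (α × Bool)} (hred : FreeGroup.Red L₁ L₂) (hne : L₂ ≠ []) (K : ℕ)
    (h : ∃ π : Perm (Fin L₁.length), IsPairingFn L₁.get π ∧ L₁.length / 2 + 1 ≤ K + vtx L₁.length π) :
    ∃ π : Perm (Fin L₂.length), IsPairingFn L₂.get π ∧ L₂.length / 2 + 1 ≤ K + vtx L₂.length π := by
  induction hred with
  | refl => exact h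
  | @tail b c _hab hbc ih =>
    have hlenbc : c.length + 2 = b.length := hbc.length
    have hbne : b ≠ [] := by
      intro hb
      rw [hb] at hlenbc
      simp at hlenbc
    obtain ⟨πb, hπb, hbound⟩ := ih hbne
    cases hbc with
    | not =>
      rename_i p s x bb
      obtain ⟨π', hπ', hle⟩ := pairing_delete p s (x, bb) hne πb hπb
      have hle' : vtx (p ++ (x, bb) :: (x, !bb) :: s).length πb ≤ vtx (p ++ s).length π' + 1 := hle
      refine ⟨π', hπ', ?_⟩
      have : (p ++ (x, bb) :: (x, !bb) :: s).length = (p ++ s).length + 2 := by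
        simp only [List.length_append, List.length_cons]
        omega
      omega

/-- **Mirror insertion**: `P⁻¹ P V` is paired (with `|P|` more vertices) if `V` is. [folklore] -/
theorem pairing_mirror (P V : List (α × Bool)) (hV : V ≠ []) (K : ℕ)
    (h : ∃ π : Perm (Fin V.length), IsPairingFn V.get π ∧ V.length / 2 + 1 ≤ K + vtx V.length π) :
    ∃ π : Perm (Fin (FreeGroup.invRev P ++ P ++ V).length),
      IsPairingFn (FreeGroup.invRev P ++ P ++ V).get π ∧
      (FreeGroup.invRev P ++ P ++ V).length / 2 + 1 ≤ K + vtx (FreeGroup.invRev P ++ P ++ V).length π := by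
  induction P with
  | nil => exact h
  | cons x P ih =>
    have e1 : FreeGroup.invRev P ++ P ++ V = FreeGroup.invRev P ++ (P ++ V) := List.append_assoc _ _ _
    obtain ⟨π, hπ, hb⟩ := pairing_congr e1 K ih
    have hne : FreeGroup.invRev P ++ (P ++ V) ≠ [] :=
      List.append_ne_nil_of_right_ne_nil _ (List.append_ne_nil_of_right_ne_nil _ hV)
    obtain ⟨π', hπ', hv'⟩ := pairing_insert (FreeGroup.invRev P) (P ++ V) (linv x) hne π hπ
    have e2 : FreeGroup.invRev P ++ linv x :: linv (linv x) :: (P ++ V) =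
        FreeGroup.invRev (x :: P) ++ x :: P ++ V := by
      simp [invRev_cons, List.append_assoc]
    refine pairing_congr e2 K ⟨π', hπ', ?_⟩
    have : (FreeGroup.invRev P ++ linv x :: linv (linv x) :: (P ++ V)).length =
        (FreeGroup.invRev P ++ (P ++ V)).length + 2 := by
      simp only [List.length_append, List.length_cons]
      omega
    omega

/-- The pairing `0 ↔ 1` of the word `y y⁻¹`. [folklore] -/
theorem isPairingFn_pair (y : α × Bool) :
    IsPairingFn ([y, linv y].get) (swap (0 : Fin 2) 1) := by
  refine ⟨fun i => swap_apply_self _ _ _, fun i => ?_, fun i => ?_⟩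
  · fin_cases i <;> simp
  · fin_cases i
    · rfl
    · change [y, linv y].get 0 = linv ([y, linv y].get 1)
      simp

/-- A marked position of an appended list. [folklore] -/
theorem getElem_append_cons_length {β : Type*} (A B : List β) (x : β) (i : ℕ) (hi : i = A.length)
    (h : i < (A ++ x :: B).length) : (A ++ x :: B)[i] = x := by
  subst hi
  rw [List.getElem_append_right (le_refl _)]
  simp

/-- **The commutator word.** For a list of pairs `(Aᵢ, Bᵢ)` there is a nonempty word
representing `∏ [Aᵢ, Bᵢ]` (spelled out, each `Aᵢ, Bᵢ` padded to length `≥ 2`) together with a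
pairing of genus at most the number of pairs: `|L|/2 + 1 ≤ 2 · #pairs + v`. [folklore] -/
theorem exists_commutator_word [DecidableEq α] (a : α) :
    ∀ l : List (FreeGroup α × FreeGroup α),
      ∃ (L : List (α × Bool)) (π : Perm (Fin L.length)), L ≠ [] ∧
        FreeGroup.mk L = (l.map fun p => p.1 * p.2 * p.1⁻¹ * p.2⁻¹).prod ∧
        IsPairingFn L.get π ∧ L.length / 2 + 1 ≤ 2 * l.length + vtx L.length π := by
  intro l
  induction l with
  | nil =>
    refine ⟨[(a, true), (a, false)], swap (0 : Fin 2) 1, by simp, ?_, isPairingFn_pair (a, true), ?_⟩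
    · rw [List.map_nil, List.prod_nil, FreeGroup.one_eq_mk]
      exact mk_append_pair [] [] (a, true)
    · have : vtx 2 (swap (0 : Fin 2) 1) = 2 := vtx_two _ (by simp) (by simp)
      change 2 / 2 + 1 ≤ 2 * 0 + vtx 2 (swap (0 : Fin 2) 1)
      omega
  | cons AB l ih =>
    obtain ⟨L', π', hne', hmk', hπ', hb'⟩ := ih
    obtain ⟨A, B⟩ := AB
    by_cases htriv : A = 1 ∨ B = 1
    · refine ⟨L', π', hne', ?_, hπ', ?_⟩
      · rw [hmk']
        rcases htriv with rfl | rfl <;> simp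
      · simp only [List.length_cons]
        omega
    have hA1 : A ≠ 1 := fun h => htriv (Or.inl h)
    have hB1 : B ≠ 1 := fun h => htriv (Or.inr h)
    -- the padded reduced words of `A` and `B`
    have pad : ∀ g : FreeGroup α, g ≠ 1 → ∃ (xh : α × Bool) (X : List (α × Bool)), X ≠ [] ∧
        FreeGroup.mk (xh :: X) = g := by
      intro g hg
      have hX : g.toWord ≠ [] := fun h => hg (FreeGroup.toWord_eq_nil_iff.1 h)
      obtain ⟨xh, X, hX'⟩ := List.exists_cons_of_ne_nil hX
      by_cases hXe : X = []
      · refine ⟨xh, [(a, true), (a, false)], by simp, ?_⟩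
        have : FreeGroup.mk (xh :: [(a, true), (a, false)]) = FreeGroup.mk [xh] := by
          simpa [linv] using mk_append_pair [xh] [] (a, true)
        rw [this, ← FreeGroup.mk_toWord (x := g), hX', hXe]
      · exact ⟨xh, X, hXe, by rw [← hX', FreeGroup.mk_toWord]⟩
    obtain ⟨xh, X, hX, hA⟩ := pad A hA1
    obtain ⟨yh, Y, hY, hB⟩ := pad B hB1
    set L : List (α × Bool) :=
      xh :: (X ++ yh :: (Y ++ FreeGroup.invRev X ++ linv xh :: (FreeGroup.invRev Y ++ linv yh :: L')))
      with hL
    have hlen : L.length = X.length + (Y.length + X.length) + Y.length + L'.length + 4 := by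
      simp only [hL, List.length_cons, List.length_append, FreeGroup.invRev_length]
      omega
    -- the element represented
    have hmk : FreeGroup.mk L = A * B * A⁻¹ * B⁻¹ * FreeGroup.mk L' := by
      rw [← hA, ← hB, FreeGroup.inv_mk, FreeGroup.inv_mk, invRev_cons, invRev_cons]
      have eL : L = [xh] ++ X ++ [yh] ++ Y ++ FreeGroup.invRev X ++ [linv xh] ++ FreeGroup.invRev Y ++
          [linv yh] ++ L' := by simp [hL]
      have e1 : FreeGroup.mk (FreeGroup.invRev X) = (FreeGroup.mk X)⁻¹ := FreeGroup.inv_mk.symm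
      have e2 : FreeGroup.mk (FreeGroup.invRev Y) = (FreeGroup.mk Y)⁻¹ := FreeGroup.inv_mk.symm
      rw [eL]
      simp only [← FreeGroup.mul_mk, mk_cons_eq xh X, mk_cons_eq yh Y, e1, e2, mk_linv]
      group
    -- the four marked letters
    have hgc : L.get ⟨X.length + (Y.length + X.length) + 2, by omega⟩ = linv (L.get ⟨0, by omega⟩) := by
      rw [List.get_eq_getElem, List.get_eq_getElem]
      have e : L = (xh :: X ++ yh :: (Y ++ FreeGroup.invRev X)) ++ linv xh ::
          (FreeGroup.invRev Y ++ linv yh :: L') := by simp [hL]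
      rw [List.getElem_of_eq e, getElem_append_cons_length _ _ _ _
        (by simp only [List.length_cons, List.length_append, FreeGroup.invRev_length]; omega)]
      rfl
    have hgd : L.get ⟨X.length + (Y.length + X.length) + Y.length + 3, by omega⟩ = linv (L.get ⟨X.length + 1, by omega⟩) := by
      rw [List.get_eq_getElem, List.get_eq_getElem]
      have e : L = (xh :: X ++ yh :: (Y ++ FreeGroup.invRev X) ++ linv xh :: FreeGroup.invRev Y) ++
          linv yh :: L' := by simp [hL]
      have e' : L = (xh :: X) ++ yh :: (Y ++ FreeGroup.invRev X ++ linv xh ::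
          (FreeGroup.invRev Y ++ linv yh :: L')) := by simp [hL]
      rw [List.getElem_of_eq e, getElem_append_cons_length _ _ _ _
        (by simp only [List.length_cons, List.length_append, FreeGroup.invRev_length]; omega),
        List.getElem_of_eq e', getElem_append_cons_length _ _ _ _ (by simp)]
    -- the surgered word and its pairing
    have hsurg : List.ofFn (L.get ∘ surgEmb X.length (Y.length + X.length) Y.length L'.length L.length hlen) =
        FreeGroup.invRev Y ++ (Y ++ FreeGroup.invRev X) ++ X ++ L' := by
      rw [ofFn_comp_surgEmb hlen L.get, List.ofFn_get]
      have d1 : L.drop 1 = X ++ (yh :: (Y ++ FreeGroup.invRev X ++ linv xh ::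
          (FreeGroup.invRev Y ++ linv yh :: L'))) := by simp [hL]
      have d2 : L.drop (X.length + 2) = (Y ++ FreeGroup.invRev X) ++ (linv xh ::
          (FreeGroup.invRev Y ++ linv yh :: L')) := by
        have e : L = (xh :: X ++ [yh]) ++ ((Y ++ FreeGroup.invRev X) ++ (linv xh ::
            (FreeGroup.invRev Y ++ linv yh :: L'))) := by simp [hL]
        rw [e, List.drop_left' (by simp)]
      have d3 : L.drop (X.length + (Y.length + X.length) + 3) = FreeGroup.invRev Y ++ (linv yh :: L') := by
        have e : L = (xh :: X ++ yh :: (Y ++ FreeGroup.invRev X) ++ [linv xh]) ++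
            (FreeGroup.invRev Y ++ (linv yh :: L')) := by simp [hL]
        rw [e, List.drop_left'
          (by simp only [List.length_cons, List.length_append, List.length_nil, FreeGroup.invRev_length]; omega)]
      have d4 : L.drop (X.length + (Y.length + X.length) + Y.length + 4) = L' := by
        have e : L = (xh :: X ++ yh :: (Y ++ FreeGroup.invRev X) ++ linv xh :: FreeGroup.invRev Y ++
            [linv yh]) ++ L' := by simp [hL]
        rw [e, List.drop_left'
          (by simp only [List.length_cons, List.length_append, List.length_nil, FreeGroup.invRev_length]; omega)]
      rw [d1, d2, d3, d4, List.take_left' (by simp [FreeGroup.invRev_length]),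
        List.take_left' (by simp [FreeGroup.invRev_length]), List.take_left' rfl]
    have hm : 0 < X.length + (Y.length + X.length) + Y.length + L'.length := by
      have : 0 < L'.length := List.length_pos_of_ne_nil hne'
      omega
    -- pairing of the surgered word, by two mirror insertions
    have h1 := pairing_mirror X L' hne' (2 * l.length) ⟨π', hπ', hb'⟩
    have h2 := pairing_mirror Y (FreeGroup.invRev X ++ X ++ L')
      (List.append_ne_nil_of_right_ne_nil _ hne') (2 * l.length) h1
    have e3 : FreeGroup.invRev Y ++ Y ++ (FreeGroup.invRev X ++ X ++ L') =
        List.ofFn (L.get ∘ surgEmb X.length (Y.length + X.length) Y.length L'.length L.length hlen) := by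
      rw [hsurg]
      simp [List.append_assoc]
    obtain ⟨πs, hπs, hbs⟩ := pairing_congr e3 _ h2
    have hls : (List.ofFn (L.get ∘ surgEmb X.length (Y.length + X.length) Y.length L'.length L.length hlen)).length =
        X.length + (Y.length + X.length) + Y.length + L'.length := by
      simp
    obtain ⟨πt, hπt, hvt⟩ := (transfer_pairing hls (F := L.get ∘ surgEmb X.length (Y.length + X.length) Y.length L'.length L.length hlen)
      (fun i => by rw [List.get_ofFn]; rfl)).1 πs hπs
    obtain ⟨π, hπ, hv⟩ := surgery_extend hlen hm ⟨0, by omega⟩ ⟨X.length + 1, by omega⟩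
      ⟨X.length + (Y.length + X.length) + 2, by omega⟩ ⟨X.length + (Y.length + X.length) + Y.length + 3, by omega⟩ rfl rfl rfl rfl L.get πt hπt hgc hgd
    refine ⟨L, π, by simp [hL], ?_, hπ, ?_⟩
    · rw [hmk, hmk']
      simp [mul_assoc]
    · rw [hv, hvt]
      simp only [List.length_cons]
      omega

/-- **Lower bound (Culler's argument).** A nonempty reduced word of the commutator subgroup
carries a pairing of genus at most its commutator length: `|w|/2 + 1 ≤ 2 cl + v`. Spell out an
optimal product of commutators as a word with a pairing of that genus (`exists_commutator_word`)
and reduce it freely (`pairing_of_red`). [cite: Heuer2020, Thm 2.4] -/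
theorem length_div_two_add_one_le (w : List (α × Bool)) (hw : w ≠ []) (hred : FreeGroup.IsReduced w)
    (hmem : FreeGroup.mk w ∈ commutator (FreeGroup α)) :
    ∃ π : Perm (Fin w.length), IsPairingFn w.get π ∧
      w.length / 2 + 1 ≤ 2 * commutatorLength (FreeGroup.mk w) + vtx w.length π := by
  classical
  obtain ⟨x, -, -⟩ := List.exists_cons_of_ne_nil hw
  obtain ⟨l, hl, hprod⟩ := exists_list_length_eq_commutatorLength hmem
  obtain ⟨L, πL, -, hmkL, hπL, hbL⟩ := exists_commutator_word x.1 l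
  rw [hprod] at hmkL
  have hred' : FreeGroup.Red L w := by
    have h1 : FreeGroup.reduce L = w := by
      rw [FreeGroup.reduce.sound hmkL, hred.reduce_eq]
    rw [← h1]
    exact FreeGroup.reduce.red
  rw [← hl]
  exact pairing_of_red hred' hw _ ⟨πL, hπL, hbL⟩

end LowerBound

end Bardakov

namespace Bardakov

section AllWords

variable {α : Type*}

open Equiv Equiv.Perm

/-- **A word reducing to nothing has a planar pairing**: if `L ≠ []` freely reduces to `[]` then
`L` carries a pairing with `|L|/2 + 1 ≤ v` (insert the cancelling pairs back one by one).
[folklore] -/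
theorem exists_pairing_of_red_nil : ∀ (n : ℕ) (L : List (α × Bool)), L.length ≤ n →
    FreeGroup.Red L [] → L ≠ [] →
      ∃ π : Perm (Fin L.length), IsPairingFn L.get π ∧ L.length / 2 + 1 ≤ 0 + vtx L.length π := by
  intro n
  induction n with
  | zero =>
    intro L hL _ hne
    exact absurd (List.eq_nil_of_length_eq_zero (Nat.le_zero.1 hL)) hne
  | succ n ih =>
    intro L hL hred hne
    rcases hred.cases_head with h | ⟨L', hstep, hrest⟩
    · exact absurd h hne
    cases hstep with
    | not =>
      rename_i p s x bb
      by_cases hps : p ++ s = []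
      · have hp : p = [] := (List.append_eq_nil_iff.1 hps).1
        have hs : s = [] := (List.append_eq_nil_iff.1 hps).2
        subst hp
        subst hs
        change ∃ π : Perm (Fin 2), IsPairingFn ([(x, bb), linv (x, bb)].get) π ∧ 2 / 2 + 1 ≤ 0 + vtx 2 π
        refine ⟨swap (0 : Fin 2) 1, isPairingFn_pair (x, bb), ?_⟩
        have : vtx 2 (swap (0 : Fin 2) 1) = 2 := vtx_two _ (by simp) (by simp)
        omega
      · have hlen : (p ++ s).length ≤ n := by
          have : (p ++ (x, bb) :: (x, !bb) :: s).length = (p ++ s).length + 2 := by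
            simp only [List.length_append, List.length_cons]
            omega
          omega
        obtain ⟨π', hπ', hb'⟩ := ih (p ++ s) hlen hrest hps
        obtain ⟨π, hπ, hv⟩ := pairing_insert p s (x, bb) hps π' hπ'
        refine ⟨π, hπ, ?_⟩
        have hv' : vtx (p ++ (x, bb) :: (x, !bb) :: s).length π = vtx (p ++ s).length π' + 1 := hv
        have : (p ++ (x, bb) :: (x, !bb) :: s).length = (p ++ s).length + 2 := by
          simp only [List.length_append, List.length_cons]
          omega
        omega

/-- **Un-reducing keeps the genus**: along `FreeGroup.Red L₁ L₂` (with `L₂ ≠ []`), a pairing of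
`L₂` with `|L₂|/2 + 1 ≤ K + v` lifts to one of `L₁`. [folklore] -/
theorem pairing_lift_red {L₁ L₂ : List (α × Bool)} (hred : FreeGroup.Red L₁ L₂) (hne : L₂ ≠ []) (K : ℕ)
    (h : ∃ π : Perm (Fin L₂.length), IsPairingFn L₂.get π ∧ L₂.length / 2 + 1 ≤ K + vtx L₂.length π) :
    ∃ π : Perm (Fin L₁.length), IsPairingFn L₁.get π ∧ L₁.length / 2 + 1 ≤ K + vtx L₁.length π := by
  induction hred using Relation.ReflTransGen.head_induction_on with
  | refl => exact h
  | head hstep hrest ih =>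
    rename_i a c
    have hcne : c ≠ [] := by
      rintro rfl
      exact hne (FreeGroup.Red.nil_iff.1 hrest)
    obtain ⟨πc, hπc, hbc⟩ := ih
    cases hstep with
    | not =>
      rename_i p s x bb
      obtain ⟨π, hπ, hv⟩ := pairing_insert p s (x, bb) hcne πc hπc
      refine ⟨π, hπ, ?_⟩
      have hv' : vtx (p ++ (x, bb) :: (x, !bb) :: s).length π = vtx (p ++ s).length πc + 1 := hv
      have : (p ++ (x, bb) :: (x, !bb) :: s).length = (p ++ s).length + 2 := by
        simp only [List.length_append, List.length_cons]
        omega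
      omega

/-- **Lower bound for every word.** Every non-empty word (reduced or not) representing an
element of the commutator subgroup carries a pairing with `|w|/2 + 1 ≤ 2 cl(w) + v` (reduce
freely, take the pairing of `length_div_two_add_one_le`, and un-reduce). This is the remark
"Bardakov's algorithm is also valid if the words are not reduced" of [Heuer2020, §3.3].
[cite: Heuer2020, §3.3] -/
theorem exists_isPairingFn_of_mem_commutator (w : List (α × Bool)) (hw : w ≠ [])
    (hmem : FreeGroup.mk w ∈ commutator (FreeGroup α)) :
    ∃ π : Perm (Fin w.length), IsPairingFn w.get π ∧
      w.length / 2 + 1 ≤ 2 * commutatorLength (FreeGroup.mk w) + vtx w.length π := by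
  classical
  have hred : FreeGroup.Red w (FreeGroup.reduce w) := FreeGroup.reduce.red
  by_cases hnil : FreeGroup.reduce w = []
  · have h1 : FreeGroup.mk w = 1 := by
      rw [← FreeGroup.reduce.self, hnil]
      rfl
    rw [hnil] at hred
    obtain ⟨π, hπ, hb⟩ := exists_pairing_of_red_nil w.length w le_rfl hred hw
    exact ⟨π, hπ, by rw [h1, commutatorLength_one]; omega⟩
  · have hr : FreeGroup.IsReduced (FreeGroup.reduce w) := by
      rw [← FreeGroup.toWord_mk]
      exact FreeGroup.isReduced_toWord
    have hmem' : FreeGroup.mk (FreeGroup.reduce w) ∈ commutator (FreeGroup α) := by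
      rwa [FreeGroup.reduce.self]
    obtain ⟨π', hπ', hb'⟩ := length_div_two_add_one_le _ hnil hr hmem'
    rw [FreeGroup.reduce.self] at hb'
    exact pairing_lift_red hred hnil _ ⟨π', hπ', hb'⟩

end AllWords

end Bardakov

/-! ### The certificate characterisation of CL-`F_r` (the mathematics of [Heuer2020, Cor 2.5]) -/

open Equiv in
/-- The empty word with any threshold is a yes-instance of CL-`F_r` (`cl(1) = 0`). [folklore] -/
theorem nil_mem_clDecisionSet (r k : ℕ) : (([] : List (Fin r × Bool)), k) ∈ clDecisionSet r := by
  refine ⟨?_, ?_⟩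
  · change FreeGroup.mk [] ∈ commutator (FreeGroup (Fin r))
    rw [← FreeGroup.one_eq_mk]
    exact one_mem _
  · change commutatorLength (FreeGroup.mk []) ≤ k
    rw [← FreeGroup.one_eq_mk, commutatorLength_one]
    exact Nat.zero_le _

open Equiv in
/-- **The pairing certificate for CL-`F_r`** ([Heuer2020, Cor 2.5]: "we may verify that
`cl_F(w) ≤ n` by providing an appropriate pairing `π ∈ Π_w`"), for RAW input words: an instance
`(w, k)` of CL-`F_r` is a yes-instance iff `w` is empty or some pairing `π` of `w` itself (a
fixed-point-free involution of its positions matching inverse letters; no reduction of `w` is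
needed) has `|w|/2 + 1 ≤ 2k + orb(σπ)`. Soundness is the upper bound
`Bardakov.two_mul_commutatorLength_add_vtx_le` (valid for every word; a paired word is
automatically in the commutator subgroup), completeness the lower bound for every word
`Bardakov.exists_isPairingFn_of_mem_commutator`. [cite: Heuer2020, Cor 2.5] -/
theorem mem_clDecisionSet_iff_exists_isPairing {r : ℕ} (w : List (Fin r × Bool)) (k : ℕ) :
    (w, k) ∈ clDecisionSet r ↔
      w = [] ∨ ∃ π : Perm (Fin w.length), IsPairing w π ∧
        w.length / 2 + 1 ≤ 2 * k + orbitCount ((finRotate w.length).trans π) := by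
  constructor
  · rintro ⟨hmem, hcl⟩
    by_cases hw : w = []
    · exact Or.inl hw
    · right
      obtain ⟨π, hπ, hb⟩ := Bardakov.exists_isPairingFn_of_mem_commutator w hw hmem
      refine ⟨π, hπ, ?_⟩
      rw [Bardakov.orbitCount_trans_eq_vtx]
      change commutatorLength (FreeGroup.mk w) ≤ k at hcl
      omega
  · rintro (rfl | ⟨π, hπ, hb⟩)
    · exact nil_mem_clDecisionSet r k
    · by_cases hw : w = []
      · subst hw
        exact nil_mem_clDecisionSet r k
      have hπ' : Bardakov.IsPairingFn w.get π := hπ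
      have hmem := Bardakov.mk_ofFn_mem_commutator hπ'
      have hup := Bardakov.two_mul_commutatorLength_add_vtx_le w.length w.get π hπ'
        (List.length_pos_of_ne_nil hw)
      rw [List.ofFn_get] at hmem hup
      rw [Bardakov.orbitCount_trans_eq_vtx] at hb
      refine ⟨hmem, ?_⟩
      change commutatorLength (FreeGroup.mk w) ≤ k
      omega

open Equiv in
/-- The same characterisation for coded instances: membership of `clInstanceCode r (w, k)` in the
language CL-`F_r`. [cite: Heuer2020, Cor 2.5] -/
theorem clInstanceCode_mem_clLanguage_iff_exists_isPairing {r : ℕ} (w : List (Fin r × Bool)) (k : ℕ) :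
    clInstanceCode r (w, k) ∈ clLanguage r ↔
      w = [] ∨ ∃ π : Perm (Fin w.length), IsPairing w π ∧
        w.length / 2 + 1 ≤ 2 * k + orbitCount ((finRotate w.length).trans π) := by
  rw [clInstanceCode_mem_clLanguage_iff]
  exact mem_clDecisionSet_iff_exists_isPairing w k

end Literature.GroupTheory.CombinatorialGroupTheory
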